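import Summits.CriticalPhenomena.CardyFormulaZ2.Theses.CardyBoundaryCoulombGas
import Summits.CriticalPhenomena.CardyFormulaZ2.Theorems.StripClusterRates.Negative.KacFromAboveFalse
import Literature.Probability.LatticeModels.RowStatePlanar
import Literature.Probability.Percolation.LatticeSymmetry
import Summits.CriticalPhenomena.CardyFormulaZ2.Theorems.CardyBoundaryCoulombGasStripClusterRatesStubOneClusterDictionary
import Summits.CriticalPhenomena.CardyFormulaZ2.Theorems.CardyBoundaryCoulombGasStripClusterRatesStubPlanarReachable
import Summits.CriticalPhenomena.CardyFormulaZ2.Theorems.CardyBoundaryCoulombGasStripClusterRatesStubOneClusterSpectral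
import Summits.CriticalPhenomena.CardyFormulaZ2.Theorems.CardyBoundaryCoulombGasStripClusterRatesStubTwoClusterDictionary
import Summits.CriticalPhenomena.CardyFormulaZ2.Theorems.CardyBoundaryCoulombGasStripClusterRatesStubRelaxationUpper
import Summits.CriticalPhenomena.CardyFormulaZ2.Theorems.CardyBoundaryCoulombGasStripClusterRatesStubRelaxationLower
import Summits.CriticalPhenomena.CardyFormulaZ2.Theorems.CardyBoundaryCoulombGasStripClusterRatesReduction
import Summits.CriticalPhenomena.CardyFormulaZ2.Theorems.CardyBoundaryCoulombGasStripClusterRatesStubBetheGroundExists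
import Summits.CriticalPhenomena.CardyFormulaZ2.Theorems.CardyBoundaryCoulombGasStripClusterRatesBetheKernelToolkit
import Summits.CriticalPhenomena.CardyFormulaZ2.Theorems.CardyBoundaryCoulombGasStripClusterRatesModulusUnique
import Summits.CriticalPhenomena.CardyFormulaZ2.Theorems.CardyBoundaryCoulombGasStripClusterRatesRelaxIsBetheWidthOne
import Summits.CriticalPhenomena.CardyFormulaZ2.Theorems.CardyBoundaryCoulombGasStripClusterRatesBetheKernelPartialFraction
import Summits.CriticalPhenomena.CardyFormulaZ2.Theorems.CardyBoundaryCoulombGasStripClusterRatesLorentzPairPosSemidef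
import Summits.CriticalPhenomena.CardyFormulaZ2.Theorems.CardyBoundaryCoulombGasStripClusterRatesBetheKernelPosSemidef
import Summits.CriticalPhenomena.CardyFormulaZ2.Theorems.CardyBoundaryCoulombGasStripClusterRatesBetheMapInjOn
import Summits.CriticalPhenomena.CardyFormulaZ2.Theorems.CardyBoundaryCoulombGasStripClusterRatesBetheGapLower
import Summits.CriticalPhenomena.CardyFormulaZ2.Theorems.CardyBoundaryCoulombGasStripClusterRatesBetheGapUpperLocal
import Summits.CriticalPhenomena.CardyFormulaZ2.Theorems.CardyBoundaryCoulombGasStripClusterRatesBetheKernelIntegral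
import Summits.CriticalPhenomena.CardyFormulaZ2.Theorems.CardyBoundaryCoulombGasStripClusterRatesBetheMomentumSecant
import Summits.CriticalPhenomena.CardyFormulaZ2.Theorems.CardyBoundaryCoulombGasStripClusterRatesBetheEscapingIndex
import Summits.CriticalPhenomena.CardyFormulaZ2.Theorems.CardyBoundaryCoulombGasStripClusterRatesBetheKernelConvBound
import Summits.CriticalPhenomena.CardyFormulaZ2.Theorems.CardyBoundaryCoulombGasStripClusterRatesStubSandwichUpper
import Summits.CriticalPhenomena.CardyFormulaZ2.Theorems.CardyBoundaryCoulombGasStripClusterRatesStubLamRLog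
import Summits.CriticalPhenomena.CardyFormulaZ2.Theorems.CardyBoundaryCoulombGasStripClusterRatesStubCardyLog
import Summits.CriticalPhenomena.CardyFormulaZ2.Theorems.CardyBoundaryCoulombGasStripClusterRatesStubComposeOne
import Summits.CriticalPhenomena.CardyFormulaZ2.Theorems.CardyBoundaryCoulombGasStripClusterRatesEscapeOfPositiveVector
import Summits.CriticalPhenomena.CardyFormulaZ2.Theorems.CardyBoundaryCoulombGasStripClusterRatesBetheReduction
import Summits.CriticalPhenomena.CardyFormulaZ2.Theorems.CardyBoundaryCoulombGasStripClusterRatesRectBoxMesh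
import Summits.CriticalPhenomena.CardyFormulaZ2.Theorems.CardyBoundaryCoulombGasStripClusterRatesRectCardyOneArcs
import Summits.CriticalPhenomena.CardyFormulaZ2.Theorems.CardyBoundaryCoulombGasStripClusterRatesRectBoxExists
import Summits.CriticalPhenomena.CardyFormulaZ2.Theorems.CardyBoundaryCoulombGasStripClusterRatesRectBoxDictionary
import Summits.CriticalPhenomena.CardyFormulaZ2.Theorems.CardyBoundaryCoulombGasStripClusterRatesRectCardyOneOfParts
import Summits.CriticalPhenomena.CardyFormulaZ2.Theorems.CardyBoundaryCoulombGasStripClusterRatesRectCardyOneOfRectilinearCardy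
import Summits.CriticalPhenomena.CardyFormulaZ2.Theorems.CardyBoundaryCoulombGasStripClusterRatesTwoClusterKacIffKacTwo
import Summits.CriticalPhenomena.CardyFormulaZ2.Theorems.CardyBoundaryCoulombGasStripClusterRatesOfRectilinearCardy
import Summits.CriticalPhenomena.CardyFormulaZ2.Theorems.CardyBoundaryCoulombGasStripClusterRatesOfCardyFormulaZ2
import Summits.CriticalPhenomena.CardyFormulaZ2.Theorems.CardyBoundaryCoulombGasStripClusterRatesOfCardyRectangle
import Summits.CriticalPhenomena.CardyFormulaZ2.Theorems.CardyBoundaryCoulombGasStripClusterRatesTwoClusterUpperWindow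
import Summits.CriticalPhenomena.CardyFormulaZ2.Theorems.CardyBoundaryCoulombGasStripClusterRatesTwoClusterCardyOrderLiminf
import Summits.CriticalPhenomena.CardyFormulaZ2.Theorems.CardyBoundaryCoulombGasStripClusterRatesTwoClusterLowerWindow
import Summits.CriticalPhenomena.CardyFormulaZ2.Theorems.CardyBoundaryCoulombGasStripClusterRatesTwoClusterQuasiMultTransfer
import Summits.CriticalPhenomena.CardyFormulaZ2.Theorems.CardyBoundaryCoulombGasStripClusterRatesTwoClusterMonotone
import Literature.Probability.Percolation.RSW
import Summits.CriticalPhenomena.CardyFormulaZ2.Theorems.CardyBoundaryCoulombGasStripClusterRatesCgTwoCluster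
import Summits.CriticalPhenomena.CardyFormulaZ2.Theorems.CardyBoundaryCoulombGasStripClusterRatesCgGluePlus
import Summits.CriticalPhenomena.CardyFormulaZ2.Theorems.CardyBoundaryCoulombGasStripClusterRatesCgGlueMinus
import Summits.CriticalPhenomena.CardyFormulaZ2.Theorems.CardyBoundaryCoulombGasStripClusterRatesCgGlueIndep
import Summits.CriticalPhenomena.CardyFormulaZ2.Theorems.CardyBoundaryCoulombGasStripClusterRatesCgRate
import Summits.CriticalPhenomena.CardyFormulaZ2.Theorems.CardyBoundaryCoulombGasStripClusterRatesCgGlueLocal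
import Summits.CriticalPhenomena.CardyFormulaZ2.Theorems.CardyBoundaryCoulombGasStripClusterRatesConfinedGlueTransfer
import Summits.CriticalPhenomena.CardyFormulaZ2.Theorems.CardyBoundaryCoulombGasStripClusterRatesKacOneOfCardyOrderOne
import Summits.CriticalPhenomena.CardyFormulaZ2.Theorems.CardyBoundaryCoulombGasStripClusterRatesCardyOrderOneOfKacOne
import Summits.CriticalPhenomena.CardyFormulaZ2.Theorems.CardyBoundaryCoulombGasStripClusterRatesCardyOrderOneOfRectCardyOne
import Summits.CriticalPhenomena.CardyFormulaZ2.Theorems.CardyBoundaryCoulombGasStripClusterRatesCardyOrderTwoLowerOfKacTwo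
import Summits.CriticalPhenomena.CardyFormulaZ2.Theorems.CardyBoundaryCoulombGasStripClusterRatesCardyOrderTransfer
import Summits.CriticalPhenomena.CardyFormulaZ2.Theorems.CardyBoundaryCoulombGasStripClusterRatesDockingOrder
import Summits.CriticalPhenomena.CardyFormulaZ2.Theorems.CardyBoundaryCoulombGasStripClusterRatesDockingSeparator
import Summits.CriticalPhenomena.CardyFormulaZ2.Theorems.CardyBoundaryCoulombGasStripClusterRatesConfinedOfDockedAux
import Summits.CriticalPhenomena.CardyFormulaZ2.Theorems.CardyBoundaryCoulombGasStripClusterRatesConfinedOfDocked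
import Summits.CriticalPhenomena.CardyFormulaZ2.Theorems.CardyBoundaryCoulombGasStripClusterRatesConfinedOfPlain
import Summits.CriticalPhenomena.CardyFormulaZ2.Theorems.CardyBoundaryCoulombGasStripClusterRatesRateConfined
import Summits.CriticalPhenomena.CardyFormulaZ2.Theorems.CardyBoundaryCoulombGasStripClusterRatesConfinedUpperOfKacTwo
import Summits.CriticalPhenomena.CardyFormulaZ2.Theorems.CardyBoundaryCoulombGasStripClusterRatesConfinedBandLower
import Summits.CriticalPhenomena.CardyFormulaZ2.Theorems.CardyBoundaryCoulombGasStripClusterRatesConfinedAprioriLower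
import Summits.CriticalPhenomena.CardyFormulaZ2.Theorems.CardyBoundaryCoulombGasStripClusterRatesQuasiMultOfSep
import Summits.CriticalPhenomena.CardyFormulaZ2.Theorems.CardyBoundaryCoulombGasStripClusterRatesUniformUpperOfSep
import Summits.CriticalPhenomena.CardyFormulaZ2.Theorems.CardyBoundaryCoulombGasStripClusterRatesPlainUpperOfUniformKacTwo
import Summits.CriticalPhenomena.CardyFormulaZ2.Theorems.CardyBoundaryCoulombGasStripClusterRatesConfinedLowerOfSepKacTwo
import Summits.CriticalPhenomena.CardyFormulaZ2.Theorems.CardyBoundaryCoulombGasStripClusterRatesKacTwoOfSepPlain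

/-!
# Line `two-cluster-rate-is-stationary-gap` for crux `CardyBoundaryCoulombGas.StripClusterRates`
(stmt-CriticalPhenomena-13878)

Crux-plan skeleton (planner `planner-cruxplan-stmt-CriticalPhenomena-13878-two-cluster-rate-is--0`,
round 1, 2026-08-16; idea card `Cruxes/StripClusterRates/Ideas/two-cluster-rate-is-stationary-gap.md`
(ideator 1; merged by the panel with `stochastic-sector-mixing-rate`), triage `TRIAGE-r1-{1,2,3}.md`:
pass × 3; line card `Lines/two-cluster-rate-is-stationary-gap.md`).

THE LINE. `StripClusterRates` asks for the two lengthwise decay rates of the free axis strip of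
bond-`ℤ²` percolation at `p = 1/2` — `γ₁(n)` of "one spanning cluster" (`crossingProb half m n`) and
`γ₂(n)` of "two distinct spanning clusters" — and for their Kac asymptotics `n·γ₁(n) → π/3 = π·h_{1,3}`,
`n·γ₂(n) → 2π = π·h_{1,5}`. The line reads BOTH rates off the ONE stochastic matrix already in the
tree, the planar `⋆`-chain `planarTransfer (Finset.Icc 0 n)` (`RowStatePlanar.lean`: one row step of
percolation acting on non-crossing connectivity patterns of the `n+1` row sites and the bottom arc `⋆`;
rows sum to `1`, `sum_planarTransfer_eq_one`). That matrix is block upper-triangular in "is some site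
joined to `⋆`": the MARKED block (transient: the cluster of the wired bottom row is still alive) and
the UNMARKED block (recurrent, itself stochastic: `⋆` is joined to nothing, Catalan-many patterns — the
stationary connectivity chain of the free strip, `≅ T|W⁰`).
* `γ₁(n)` is the ESCAPE RATE of the chain from the marked block: `e^{-γ₁(n)}` is the Perron root
  (spectral radius) of the marked block — `p₁(m,n) = P_wired[marked at time m]` EXACTLY (transposition
  `real_tbCrossing` + the row-transfer dictionary), the block is irreducible, and the tree's proved
  Perron–Frobenius fact `DingZhou2009_thm_2_6_holds` gives `c_n ρ^m ≤ p₁ ≤ C_n ρ^m`.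
* `γ₂(n)` is the RELAXATION RATE of the stationary chain: `e^{-γ₂(n)}` is the second-largest
  eigenvalue modulus (SLEM) of the unmarked block — THE LEVER of the card. Dictionary (verified exactly
  on six rectangles, `compute/dictionary_check.out`; `p₂(2,2) = 39/1024` = Disproof §4):
  `p₂(m,n) = E_{H₀} P[X_m^{alljoined} ≠ X_m^{horizRel H₀ free}]`, the grand (same-edges, monotone) coupling
  of the UNMARKED chain started from its top pattern (all sites joined, `⋆` apart) and from the random
  bottom row; the `⋆`-forgetting map is `rowStep`-equivariant, which is why no marked mode (rate `γ₁ < γ₂`)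
  enters; then `c s^m ≤ P[disagree] ≤ C_n m^k s^m` with `s` = SLEM (lower: a SLEM-eigenvector is
  non-constant and every function on a finite poset is a difference of two monotone ones; upper: Gelfand's
  formula for `U - 1π` on the block). The representation-theoretic reading of the card (Loewy `W⁰ ≃ L⁰ → L⁴`
  at `β = 1`, SLEM `=` Perron root of `T|W⁴`) is a corollary the line does not need.
* The VALUES are then two spectral-asymptotics statements about explicit rational matrices:
  `n·(-log ρ_marked(n)) → π/3` (S3) and `n·(-log SLEM_unmarked(n)) → 2π` (S4, hardest; the card's transfer
  target in the sector where the Perron value is exactly `1`). Numerically (Disproof §4, n ≤ 12/11, and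
  this seat's `compute/starchain_n5.out`, n ≤ 5, to 1e-12): `ρ_marked = e^{-γ₁}`, `SLEM = e^{-γ₂}`, both
  `n·γ` increasing towards the Kac values from BELOW (honours `Negative.KacFromAboveFalse`).

REGISTERED STUBS — RESHAPED by the line lead (prover-line-stmt-CriticalPhenomena-13878-0, 2026-08-16; see
the section "Reshape by the line lead" below for the seven registered stubs, their sizes and the proved glue).
The planner's four statements S1–S4 are KEPT as named intermediate statements (`OneClusterRateIsEscapeRate`,
`TwoClusterRateIsRelaxationRate`, `EscapeRateKac`, `RelaxationRateKac`): S1 and S2 are now DERIVED (no `sorry`)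
from the dictionary / reachability / spectral stubs D1, D2, S1', D3, S2a, S2b, and S3 ∧ S4 is the single
lead-held stub K = `stub_kacGapAsymptotics`.  Every stub is stated over TREE VOCABULARY ONLY
(`crossingProb`, `half`, `bondPercolation`, `zdGraph`, `leftSide/rightSide/rectangle`, `openConnIn`,
`PlanarRowState`, `planarTransfer`, `planarRowStep`, `hEdges`, `RowState.JoinedToStar`, `RowState.free`,
`Fintype.piFinset`, `List.foldl`, Mathlib) so that each lands verbatim as
`Summits/CriticalPhenomena/CardyFormulaZ2/Theorems/CardyBoundaryCoulombGasStripClusterRates<Stub>.lean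
--supports stmt-CriticalPhenomena-13878` in THIS namespace; the named `def`s are READABLE COPIES certified
equal to the stubs by the `*_holds` theorems, and `Registered.stub_*` are the name-keyed aliases the skeleton
audit admits as hypotheses of `StripClusterRates_of`.  Planner's original list, for reference:
* S1 `OneClusterRateIsEscapeRate`     (M/L) — `γ₁(n)` exists and `e^{-γ₁(n)}` = Perron root of the marked block;
* S2 `TwoClusterRateIsRelaxationRate` (L)   — `γ₂(n)` exists and `e^{-γ₂(n)}` = SLEM of the unmarked block;
* S3 `EscapeRateKac`                  (open-problem) — `n·(-log ρ_marked(n)) → π/3`;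
* S4 `RelaxationRateKac`              (open-problem, HARDEST) — `n·(-log SLEM_unmarked(n)) → 2π`.

DISPROOF USED (`Cruxes/StripClusterRates/Disproof.lean`, cdisprove cycle 1, NO KILL; landed
`Theorems/StripClusterRates/Negative/KacFromAboveFalse.lean`, imported here so the scratch check sees it):
there is NO `_false_without_<H>` theorem (§1: the only hypothesis `1 ≤ n` is not load-bearing) — nothing
to honour by a dedicated stub; `1 ≤ n` is kept in S1–S4 because at width `0` the unmarked block is `1×1`
and has no eigenvalue `≠ 1` (S2's SLEM clause would be unsatisfiable). `Negative.not_kacLowerBoundEveryWidth_one/_two`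
(Kac values are NOT lower bounds at small widths) — RESPECTED: S3/S4 claim `π/3`, `2π` only as `n → ∞`
limits, and S1/S2 give the refuter's exact anchors as corollaries (`γ₂(1) = 3 log 2`: the unmarked block at
`n = 1` is `[[5/8,3/8],[1/2,1/2]]`, SLEM `1/8`; `γ₁(1) = log(8/(3+√5))`: Perron root `(3+√5)/8` of the
`3×3` marked block) — i.e. the line CLOSES the Disproof's §6 near-misses `rate₂_width_one`,
`rate₁_width_one` once S1/S2 land. No stub is an instance of a landed Negative lemma (none is a per-width
Kac bound; none is `StripClusterRates` with a hypothesis dropped). Negatives index (8 items; CardyFormulaZ2: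
stmt-0748, stmt-6949): no contact.
-/

noncomputable section

namespace Summit.CriticalPhenomena.CardyFormulaZ2.Cruxes.StripClusterRates.TwoClusterRateIsStationaryGap

open Filter Topology
open scoped BigOperators Classical
open Literature.Probability.Percolation Literature.Probability.LatticeModels

/-! ## Vocabulary (readable local names; the registered stubs inline all of them) -/

/-- The columns `{0,…,n}` of the chain = the `n+1` ROWS of the crux's rectangle `[0,m]×[0,n]` after the
transposition `(x,y) ↦ (y,x)` of `ℤ²` (`real_tbCrossing`); chain time = crux length `m`. -/
abbrev cols (n : ℕ) : Finset ℤ := Finset.Icc (0 : ℤ) n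

/-- `γ` is the one-cluster lengthwise rate of width `n` (first `Tendsto` of the crux). -/
def OneClusterRate (n : ℕ) (γ : ℝ) : Prop :=
  Tendsto (fun m : ℕ ↦ -Real.log (crossingProb half m n) / (m : ℝ)) atTop (𝓝 γ)

/-- The crux's second event, verbatim: two open LR crossings of `[0,m]×[0,n]` in distinct open clusters
of the rectangle. -/
def twoClusterEvent (m n : ℕ) : Set (BondConfig (Site 2)) :=
  {ω | ∃ x₁ ∈ (leftSide m n : Set (Site 2)), ∃ y₁ ∈ (rightSide m n : Set (Site 2)),
    ∃ x₂ ∈ (leftSide m n : Set (Site 2)), ∃ y₂ ∈ (rightSide m n : Set (Site 2)),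
      ω ∈ openConnIn (rectangle m n : Set (Site 2)) x₁ y₁ ∧
      ω ∈ openConnIn (rectangle m n : Set (Site 2)) x₂ y₂ ∧
      ω ∉ openConnIn (rectangle m n : Set (Site 2)) x₁ x₂}

/-- `γ` is the two-cluster lengthwise rate of width `n` (second `Tendsto` of the crux). -/
def TwoClusterRate (n : ℕ) (γ : ℝ) : Prop :=
  Tendsto (fun m : ℕ ↦ -Real.log ((bondPercolation (zdGraph 2) half).real (twoClusterEvent m n)) /
    (m : ℝ)) atTop (𝓝 γ)

/-- `(μ, v)` is an eigenpair of the MARKED block of `planarTransfer (cols n)` (patterns with some site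
joined to `⋆`): `v` is supported on marked patterns, `v ≠ 0`, and the block eigen-equation holds row by
row (for a marked row `p` the full sum `∑_q T p q v q` IS the block sum, `v` vanishing off the block). -/
def IsMarkedEigenpair (n : ℕ) (μ : ℂ) (v : PlanarRowState (cols n) → ℂ) : Prop :=
  v ≠ 0 ∧ (∀ p, (∀ x, ¬ p.1.JoinedToStar x) → v p = 0) ∧
    ∀ p, (∃ x, p.1.JoinedToStar x) → ∑ q, (planarTransfer (cols n) p q : ℂ) * v q = μ * v p

/-- `(μ, v)` is an eigenpair of the UNMARKED block of `planarTransfer (cols n)` (the stationary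
connectivity chain: `⋆` joined to no site; from such a pattern the chain never charges a marked one). -/
def IsUnmarkedEigenpair (n : ℕ) (μ : ℂ) (v : PlanarRowState (cols n) → ℂ) : Prop :=
  v ≠ 0 ∧ (∀ p, (∃ x, p.1.JoinedToStar x) → v p = 0) ∧
    ∀ p, (∀ x, ¬ p.1.JoinedToStar x) → ∑ q, (planarTransfer (cols n) p q : ℂ) * v q = μ * v p

/-- `r` is the ESCAPE MODULUS of width `n`: the spectral radius (Perron root) of the marked block. -/
def IsEscapeModulus (n : ℕ) (r : ℝ) : Prop :=
  (∃ (μ : ℂ) (v : PlanarRowState (cols n) → ℂ), IsMarkedEigenpair n μ v ∧ ‖μ‖ = r) ∧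
    ∀ (μ : ℂ) (v : PlanarRowState (cols n) → ℂ), IsMarkedEigenpair n μ v → ‖μ‖ ≤ r

/-- `s` is the RELAXATION MODULUS of width `n`: the second-largest eigenvalue modulus (SLEM) of the
unmarked (stochastic) block — the largest `‖μ‖` over its eigenvalues `μ ≠ 1`. -/
def IsRelaxationModulus (n : ℕ) (s : ℝ) : Prop :=
  (∃ (μ : ℂ) (v : PlanarRowState (cols n) → ℂ), IsUnmarkedEigenpair n μ v ∧ μ ≠ 1 ∧ ‖μ‖ = s) ∧
    ∀ (μ : ℂ) (v : PlanarRowState (cols n) → ℂ), IsUnmarkedEigenpair n μ v → μ ≠ 1 → ‖μ‖ ≤ s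

/-! ## Named statements (readable copies; the registered stubs below restate them verbatim) -/

/-- S1 · ONE-CLUSTER RATE = ESCAPE RATE (the `k = 1` half of the route's foreseen `RateIsGap`; provable
now). For every width `n ≥ 1` the rate `γ₁(n) = lim -log p₁(m,n)/m` EXISTS and `e^{-γ₁(n)}` is the Perron
root of the marked block. Proof sketch: (i) dictionary `p₁(m,n) = crossingProb half m n = P(TB crossing of
[0,n]×[0,m])` (`real_tbCrossing`) `= (planarBoundary ᵥ* T^m) ⬝ planarReadout` — the law of the row-`m`
connectivity pattern inside the rectangle with the bottom row wired is the `⋆`-chain at time `m` started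
from `wired` (induction on `m` over `rowStep O H`; the informal item RowTransferExactness of route
CardyPolygonWords), and "some site joined to `⋆`" = "row `m` meets the cluster of row `0`"; (ii) the
readout mass is `δ_wired M^m 1` for the marked block `M ≥ 0`; (iii) `M` is IRREDUCIBLE on the planar
marked patterns: every marked pattern reaches `wired` in ONE step (all edges open) and `wired` reaches
every planar marked pattern (induction on the gaps of the `⋆`-block: its columns open vertically from the
wired row, the sub-partition inside each gap realised by the inductive hypothesis in the top rows above
closed edges; checked n ≤ 5, `compute/starchain_n5.out`), so the tree's PROVED Perron–Frobenius fact
`Literature.LinearAlgebra.Matrix.DingZhou2009_thm_2_6_holds` gives `r > 0`, a positive eigenvector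
`Mx = r x` and the domination `‖μ‖ ≤ r` of every complex eigenpair — i.e. the inlined "escape modulus"
clause with `μ = r`; (iv) two-sided bound `r^m · x(wired)/max x ≤ δ_wired M^m 1 ≤ r^m · x(wired)/min x`
(from `M^m x = r^m x`, `x > 0`), so `-log p₁(m,n)/m → -log r` with an `O(1/m)` error: the limit EXISTS and
`e^{-γ₁} = r`. Corollary: `γ₁(1) = log(8/(3+√5))` (Disproof §6 `rate₁_width_one`). Size M/L (the dictionary
induction is the bulk; Perron–Frobenius is in the tree). [BondesanJacobsenSaleur2012 §2, §5.1; Cardy2001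
§7.1; BlöteNightingale1982; DingZhou2009 Thm 2.6] -/
def OneClusterRateIsEscapeRate : Prop :=
  ∀ n : ℕ, 1 ≤ n → ∃ γ : ℝ, OneClusterRate n γ ∧ IsEscapeModulus n (Real.exp (-γ))

/-- S2 · TWO-CLUSTER RATE = RELAXATION RATE — THE LEVER (card C⁺ part 1, `StationaryGapIsTwoClusterRate`,
in elementary eigenpair language and with existence of the rate included). For every `n ≥ 1`,
`γ₂(n) = lim -log p₂(m,n)/m` EXISTS and `e^{-γ₂(n)}` is the SLEM of the unmarked block. Proof sketch
(probabilistic route (P) of the card, made exact by this seat): (i) `twoClusterEvent = disagreementEvent`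
(wired-vs-free disagreement of the far-side pattern; PROVED, `SketchIdeator1.disagreementEvent_eq_twoClusterEvent`);
(ii) the `⋆`-forgetting map `Φ` (restrict the partition to the sites, `⋆` a singleton) satisfies
`Φ ∘ rowStep O H = rowStep O H ∘ Φ`, so the site pattern of the wired chain is the UNMARKED chain started
from `Φ(wired) = alljoined`; hence `p₂(m,n) = E_{H₀} P[X_m^{alljoined} ≠ X_m^{horizRel H₀ free}]` under the
same-edges coupling (checked EXACTLY against the literal events on `(m,n) ∈ {(1,1),(2,1),(3,1),(1,2),(2,2),(1,3)}`,
`compute/dictionary_check.out`), and `2^{-n} d(m) ≤ p₂(m,n) ≤ d(m)`, `d(m) := P[X_m^{alljoined} ≠ X_m^{free}]`,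
by monotonicity of `rowStep` in the refinement order (`vertRel_mono`, `le_horizRel`); (iii) SANDWICH for the
monotone grand coupling of a finite chain with top and bottom: `d(m) ≤ ∑_{y<y'} (U^m f_{yy'})(top) - (U^m f_{yy'})(bot)
≤ C_n ‖(U - 1π)^m‖` (`f_{yy'} = 1{y ∼ y'}` increasing; Gelfand ⇒ rate `≥ -log s`), and for a SLEM eigenpair
`Uv = μv`, `μ ≠ 1` (so `v` non-constant; write `Re v`, `Im v` as differences of increasing functions on the
finite lattice of patterns; for `x, y` arbitrary compare both with `bot`, using `X^bot ≤ X^x ≤ X^top`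
pathwise): `s^m · osc(v) ≤ C'_n d(m)` (rate `≤ -log s`). So the limit exists and equals `-log s`;
`0 < s < 1` and `spec(U - 1π) = spec(U) ∖ {1} ∪ {0}` because the block `U` is stochastic
(`sum_planarTransfer_eq_one` + no unmarked → marked transition) and IRREDUCIBLE APERIODIC on ALL planar
unmarked patterns: `free` is reached from anywhere in one step (all vertical edges closed), and every
non-crossing partition of the sites is reached from `free` (induction on the gaps of the block of site `0`:
one bottom row of open horizontal edges under that block, its columns open vertically, each gap's
sub-partition realised inductively in the top rows above closed edges; checked n ≤ 5, 132/132 at n = 5).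
Corollary: `γ₂(1) = 3 log 2` (block `[[5/8,3/8],[1/2,1/2]]`, SLEM `1/8`;
Disproof §6 `rate₂_width_one`). The Loewy reading (`rad W⁰ ≅ L⁴` at `β = 1`, SLEM = Perron root of `T|W⁴`,
MDKP2017 §3.2, RidoutSaintAubin2014) is NOT needed. Size L. [LevinPeresWilmer2009 §12.2 and Cor. 12.6
(spectral form of mixing), Prop. 4.7/§5 (grand coupling); BondesanJacobsenSaleur2012 p. 16;
MorinDuchesneKlumperPearce2017 §3.2; arXiv:1204.4505] -/
def TwoClusterRateIsRelaxationRate : Prop :=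
  ∀ n : ℕ, 1 ≤ n → ∃ γ : ℝ, TwoClusterRate n γ ∧ IsRelaxationModulus n (Real.exp (-γ))

/-- S3 · KAC ASYMPTOTICS OF THE ESCAPE RATE (`h_{1,3} = 1/3`): `n·(-log ρ_marked(n)) → π/3`. Equivalent,
given S1, to the `γ₁` clause of the crux (uniqueness of limits) — the gain is the venue: `ρ_marked(n)` is the
Perron root of an explicit nonnegative rational matrix, with the two-sided Collatz–Wielandt bounds
`min_p (Mv)_p/v_p ≤ ρ ≤ max_p (Mv)_p/v_p` from ONE positive test vector, monotone in the block (domain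
monotonicity), and in the Temperley–Lieb(`β=1`) link basis it is the Perron root of
`2^{-(2n+1)}∏(1+e_{2j})∏(1+e_{2j-1})` on the standard module `W₂` (BJS §5.5; tree `transferLin_eq_noncommProd`).
Known mechanisms (all still to be made rigorous, none owned by this line): the brick matrix is a RATIO
`t(v₁)⁻¹t(v₀)` of Sklyanin's commuting open STAGGERED transfer matrices (light-cone lattice; it is NOT in
MDKP's homogeneous family `D(u)` — triage F2, `[B,H] ≠ 0`), so open-chain Bethe ansatz at `Δ = -1/2` with
inhomogeneities (card doubled-bethe-kozlowski, re-sited) or the diagonal-strip `D(π/6)` + `D₃` Y-system/TBA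
(cards vesica-zero-free-perron-branch, scaling-tba-positive-logs) transported to the axis strip by
`dkkmo_crossing_rotation_invariance` (card diagonal-strip-dkkmo-transfer) and pulled back through S1.
Numerics: `n·(-log ρ) = 0.42387, 0.60763, 0.70893, 0.77275, 0.81651, …, 0.93872` (n = 1..12), slopes of
`1/(-log ρ)` ↑ `3/π` (Disproof §4; this seat n ≤ 5). Claimed ONLY as a limit, approached from below
(`Negative.not_kacLowerBoundEveryWidth_one`). Size: open-problem. [Cardy1998 eq. (bb); CardyJPhysA1992;
MorinDuchesneKlumperPearce2017 §3.7; DegierEtAl2005 §3.1; Kozlowski2018; DKKMT2022; arXiv:1207.7005 §5.5] -/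
def EscapeRateKac : Prop :=
  ∀ r : ℕ → ℝ, (∀ n : ℕ, 1 ≤ n → IsEscapeModulus n (r n)) →
    Tendsto (fun n : ℕ ↦ (n : ℝ) * -Real.log (r n)) atTop (𝓝 (Real.pi / 3))

/-- S4 · KAC ASYMPTOTICS OF THE RELAXATION RATE (`h_{1,5} = 2`) — the card's transfer target, HARDEST:
`n·(-log SLEM_unmarked(n)) → 2π`. Equivalent, given S2, to the `γ₂` clause; the gain (card "Transfer",
triage-sharpened): the object is a genuinely STOCHASTIC matrix with Perron value exactly `1`, so the
quantity is a relaxation rate with two-sided characterisations that need one good test object rather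
than a diagonalisation — `SLEM = lim d(m)^{1/m}` for the monotone coupling (S2); from ABOVE, `SLEM ≤` the
contraction factor of an explicit metric on patterns under that coupling (`γ₂ ≥ …`); from BELOW, Wilson's
lemma: one explicit near-eigenfunction `Φ` with small defect `‖UΦ - λΦ‖` forces `SLEM ≥ λ - (defect term)`
(`γ₂ ≤ …`; the CFT says `Φ` = lattice `h_{1,5}` field = "two distinct clusters through the row", a quadratic
functional of the pattern); sharpness needs `Φ_n`, metric with factors `e^{-2π/n + o(1/n)}`. Reversibility is NOT available
(the chain is non-reversible) and — triage r1-1/2/3 — the EXACT Razumov–Stroganov/qKZ stationary law and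
the size recursion belong to the DIAGONAL chain `D(π/6)|W⁰` of MDKP, not to this axis chain (whose
stationary law is layer-order dependent, `compute/stationary_vs_RS.py` of triager 1; conjecturally the
STAGGERED specialisation of the inhomogeneous open qKZ solution — unverified, the lead's cheapest next
check). Alternative feeds as for S3 (Bethe `d = 4` sector / diagonal TBA subcase B + DKKMO loop form +
S2 backwards). Calibration target on the way (card stochastic-sector-mixing-rate C¹, triage r1-2 E1):
odd site numbers, `W₁ ⊃ I₃`, `N·gap → π`. Numerics: `n·(-log SLEM) = log 8, 3.22756, 3.91744, 4.36862,
4.68305, …, 5.49848` (n = 1..11), slopes of `1/(-log SLEM)` ↑ `1/(2π)`, slope ratio → 6 (pure stiffness: 4)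
(Disproof §4; this seat n ≤ 5 to 1e-12). Claimed ONLY as a limit (`Negative.not_kacLowerBoundEveryWidth_two`:
`n·γ₂(n) < 2π` for `n ≤ 3`). Size: open-problem. [Cardy1998 eq. (bb); MorinDuchesneKlumperPearce2017 §3.7
(d = 4, subcase B); DegierEtAl2005 §3.1/§6; PasquierSaleur1990; LevinPeresWilmer2009 §13.2 (Wilson's
method); DiFrancescoZinnJustin2005 (math-ph/0410061); arXiv:1610.04006] -/
def RelaxationRateKac : Prop :=
  ∀ s : ℕ → ℝ, (∀ n : ℕ, 1 ≤ n → IsRelaxationModulus n (s n)) →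
    Tendsto (fun n : ℕ ↦ (n : ℝ) * -Real.log (s n)) atTop (𝓝 (2 * Real.pi))


/-! ## Reshape by the line lead (prover-line-stmt-CriticalPhenomena-13878-0, 2026-08-16)

STATUS after wave 1 (2026-08-16 06:10Z): ALL SIX FIRM STUBS LANDED (imported above from `Theorems/`):
D1 `stub_oneClusterDictionary` p83777, D2 `stub_planarReachable` p80646, S1' `stub_oneClusterSpectral` p80701,
D3 `stub_twoClusterDictionary` p81642, S2a `stub_relaxationUpper` p84271, S2b `stub_relaxationLower` p80641 (workers of the lead,
drefute r1–r4: all survive). The only remaining `sorry` is K `stub_kacGapAsymptotics` — the open core, EQUIVALENT to the crux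
(`Theorems/CardyBoundaryCoulombGasStripClusterRatesReduction.lean`: `stripClusterRates_iff_kacGapAsymptotics`, with the assembled
RateIsGap theorems `oneClusterRate_eq_escapeRate`, `twoClusterRate_eq_relaxationRate`); its exact Bethe-ansatz form is in
`DREFUTE-r4-survivors.md` §3 (Kac constants confirmed to 8 digits, n ≤ 4096). Lead's outcome: promote-stub K.

Same composition idea, seven registered stubs (`stubs_max`): the firm stubs S1/S2 are split into a
PERCOLATION ↔ CHAIN DICTIONARY part, a REACHABILITY part and a pure SPECTRAL part (so that independent
workers run in parallel on well-sized targets), and the two open-problem value stubs S3 ∧ S4 are merged into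
the single stub `stub_kacGapAsymptotics` (the route's foreseen `KacGapAsymptotics`, `d = 2, 4`), held by the
lead.  Common currency between the percolation side and the spectral side is the COUNTING form of the chain:
sequences `seq : Fin m → Finset S × Finset S` of (vertical, horizontal) bond configurations with
`seq t ∈ univ ×ˢ (hEdges S).powerset` (exactly the normalisation of `PercolationRowTransfer`), iterated by
`List.foldl` over `planarRowStep` from a deterministic start.

* D1 `stub_oneClusterDictionary` (L) — `crossingProb half m n` = fraction of sequences whose iterate from the
  WIRED state has some site joined to `⋆` (row-transfer exactness for the one-arc readout).
* D2 `stub_planarReachable` (L) — every planar MARKED state is an iterate of the wired state and every planar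
  UNMARKED state is an iterate of the free state (the "gap induction"/comb construction; with the one-step
  facts "marked → wired", "anything → free" proved by the spectral workers this is irreducibility of the two
  blocks).
* S1' `stub_oneClusterSpectral` (M) — D1 → D2(marked) → S1 (Perron–Frobenius `DingZhou2009_thm_2_6_holds` on
  the marked block + squeeze).
* D3 `stub_twoClusterDictionary` (L) — `c · dis n m ≤ p₂(m,n) ≤ dis n m`, `dis n m` = fraction of sequences on
  which the iterates from ALLJOINED (`⋆` apart) and from FREE disagree (grand coupling; the event identity
  `disagreement = two clusters`, `Φ`-equivariance of `⋆`-forgetting, monotonicity for the random free start).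
* S2a `stub_relaxationUpper` (L) — spectral structure of the unmarked block: an SLEM `s` exists (some unmarked
  eigenpair `μ ≠ 1` has `‖μ‖ = s`, all have `‖μ‖ ≤ s`) and `dis n m ≤ C_{s'} s'^m` for every `s' > s`
  (eigenvalue `1` is simple because every state reaches `free` in one step; invariant complement
  `range (U - 1)`; Gelfand's formula).
* S2b `stub_relaxationLower` (M/L) — for every unmarked eigenpair `μ ≠ 1`: `c ‖μ‖^m ≤ dis n m` (monotone grand
  coupling: `free ≤ x ≤ alljoined` pathwise, every function is a difference of two monotone ones).
* K `stub_kacGapAsymptotics` (open-problem; the lead's) — `EscapeRateKac ∧ RelaxationRateKac` (S3 ∧ S4).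
Glue proved below (no `sorry`): S1 from D1, D2, S1'; S2 from D3, S2a, S2b and the landed Negative lemma
`pTwo_ge` (`s ≥ 1/8 > 0`) via `tendsto_rate_of_geometric_bounds`; the crux from S1, S2, K as before.
-/

/-! ### Counting vocabulary (readable local names; the registered stubs inline all of them) -/

/-- The free state as a planar state. -/
def freeP (n : ℕ) : PlanarRowState (cols n) := ⟨RowState.free (cols n), RowState.isPlanar_free (cols n)⟩

/-- The ALLJOINED state: all sites in one class, `⋆` apart (one step from `free` with every bond open). -/
def alljoined (n : ℕ) : PlanarRowState (cols n) := planarRowStep Finset.univ (hEdges (cols n)) (freeP n)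

/-- Iterate the deterministic row steps of a sequence of bond configurations (time `0` first). -/
def iter {n m : ℕ} (seq : Fin m → Finset (cols n) × Finset (cols n)) (p : PlanarRowState (cols n)) :
    PlanarRowState (cols n) :=
  (List.ofFn seq).foldl (fun r OH => planarRowStep OH.1 OH.2 r) p

/-- The admissible sequences of length `m`: `(O_t, H_t)` with `H_t ⊆ hEdges S` (normalisation of
`PercolationRowTransfer`). -/
def seqs (n m : ℕ) : Finset (Fin m → Finset (cols n) × Finset (cols n)) :=
  Fintype.piFinset fun _ : Fin m => (Finset.univ : Finset (Finset (cols n))) ×ˢ (hEdges (cols n)).powerset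

/-- The total weight `(2^{|S|} 2^{|hEdges S|})^m`. -/
def total (n m : ℕ) : ℝ := ((2 : ℝ) ^ (cols n).card * 2 ^ (hEdges (cols n)).card) ^ m

/-- `cnt₁ n m`: fraction of sequences whose iterate from `wired` is MARKED (some site joined to `⋆`). -/
def cnt₁ (n m : ℕ) : ℝ :=
  (((seqs n m).filter fun seq => ∃ x, (iter seq (PlanarRowState.wired (cols n))).1.JoinedToStar x).card : ℝ) /
    total n m

/-- `dis n m`: fraction of sequences on which the iterates from `alljoined` and from `free` DISAGREE. -/
def dis (n m : ℕ) : ℝ :=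
  (((seqs n m).filter fun seq => iter seq (alljoined n) ≠ iter seq (freeP n)).card : ℝ) / total n m

/-! ### Named statements of the reshaped stubs -/

/-- D1 · ONE-CLUSTER DICTIONARY (row-transfer exactness for the one-arc readout). -/
def OneClusterDictionary : Prop := ∀ m n : ℕ, crossingProb half m n = cnt₁ n m

/-- D2 · PLANAR REACHABILITY: marked planar states are iterates of `wired`, unmarked ones of `free`. -/
def PlanarReachable : Prop :=
  (∀ (n : ℕ) (q : PlanarRowState (cols n)), (∃ x, q.1.JoinedToStar x) →
    ∃ l : List (Finset (cols n) × Finset (cols n)),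
      l.foldl (fun r OH => planarRowStep OH.1 OH.2 r) (PlanarRowState.wired (cols n)) = q) ∧
  (∀ (n : ℕ) (q : PlanarRowState (cols n)), (∀ x, ¬ q.1.JoinedToStar x) →
    ∃ l : List (Finset (cols n) × Finset (cols n)),
      l.foldl (fun r OH => planarRowStep OH.1 OH.2 r) (freeP n) = q)

/-- S1' · ONE-CLUSTER SPECTRAL STEP: D1 and the marked half of D2 give S1. -/
def OneClusterSpectral : Prop :=
  OneClusterDictionary →
  (∀ (n : ℕ) (q : PlanarRowState (cols n)), (∃ x, q.1.JoinedToStar x) →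
    ∃ l : List (Finset (cols n) × Finset (cols n)),
      l.foldl (fun r OH => planarRowStep OH.1 OH.2 r) (PlanarRowState.wired (cols n)) = q) →
  OneClusterRateIsEscapeRate

/-- D3 · TWO-CLUSTER DICTIONARY: `p₂(m,n)` is two-sided comparable with the coupling disagreement `dis n m`. -/
def TwoClusterDictionary : Prop :=
  ∀ n : ℕ, 1 ≤ n → ∃ c : ℝ, 0 < c ∧ ∀ m : ℕ,
    c * dis n m ≤ (bondPercolation (zdGraph 2) half).real (twoClusterEvent m n) ∧
    (bondPercolation (zdGraph 2) half).real (twoClusterEvent m n) ≤ dis n m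

/-- S2a · RELAXATION UPPER: the unmarked block has an SLEM `s` and `dis n m ≤ C s'^m` for every `s' > s`. -/
def RelaxationUpper : Prop :=
  ∀ n : ℕ, 1 ≤ n → ∃ s : ℝ, IsRelaxationModulus n s ∧
    ∀ s' : ℝ, s < s' → ∃ C : ℝ, ∀ m : ℕ, dis n m ≤ C * s' ^ m

/-- S2b · RELAXATION LOWER: every unmarked eigenvalue `μ ≠ 1` is seen by the disagreement: `c‖μ‖^m ≤ dis`. -/
def RelaxationLower : Prop :=
  ∀ n : ℕ, 1 ≤ n → ∀ (μ : ℂ) (v : PlanarRowState (cols n) → ℂ), IsUnmarkedEigenpair n μ v → μ ≠ 1 →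
    ∃ c : ℝ, 0 < c ∧ ∀ m : ℕ, c * ‖μ‖ ^ m ≤ dis n m

/-- K · KAC GAP ASYMPTOTICS (`d = 2, 4`): S3 ∧ S4 — the open core of the crux. -/
def KacGapAsymptotics : Prop := EscapeRateKac ∧ RelaxationRateKac

/-! ## Registered stubs (`sorry` lives only in these seven theorems; statements inline the named `def`s
over tree vocabulary: `cols n ↦ Finset.Icc (0 : ℤ) n`, `freeP`, `alljoined`, `iter`, `seqs`, `total`,
`cnt₁`, `dis` and the eigenpair / modulus predicates expanded) -/

-- stub_oneClusterDictionary: LANDED (imported from Theorems/CardyBoundaryCoulombGasStripClusterRatesStubOneClusterDictionary.lean).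

-- stub_planarReachable: LANDED (imported from Theorems/CardyBoundaryCoulombGasStripClusterRatesStubPlanarReachable.lean).

-- stub_oneClusterSpectral: LANDED (imported from Theorems/CardyBoundaryCoulombGasStripClusterRatesStubOneClusterSpectral.lean).

-- stub_twoClusterDictionary: LANDED (imported from Theorems/CardyBoundaryCoulombGasStripClusterRatesStubTwoClusterDictionary.lean).

-- stub_relaxationUpper: LANDED (imported from Theorems/CardyBoundaryCoulombGasStripClusterRatesStubRelaxationUpper.lean).

-- stub_relaxationLower: LANDED (imported from Theorems/CardyBoundaryCoulombGasStripClusterRatesStubRelaxationLower.lean).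

/-! ## Reshape 2 by the continuation lead (prover-line-stmt-CriticalPhenomena-13878-c1-0, 2026-08-16):
K in BETHE-ANSATZ FORM

drefute r4 §3 (`DREFUTE-r4-survivors.md`; Yung–Batchelor 1995 §2–3, Sklyanin's double-row transfer matrix with
alternating inhomogeneities IS the axis transfer matrix with free boundaries; evaluated at the isotropic point
`u = -λ/2`, `λ = iγ`, `γ = π/3`, `N = 2n+2` strands) gives BOTH moduli of K as the value of ONE explicit product at a
real solution of ONE explicit system of real equations: with
  `F(w) = arctan((2+√3)·tanh w) + arctan(tanh w)`   (`= atan(tanh w·cot(γ/4)) + atan(tanh w·cot(3γ/4))`),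
  `G(x) = arctan(tanh x/√3)`                        (`= atan(tanh x·cot γ)`),
  `f(w) = (4 sinh² w + 2)/(4 sinh² w + 2 - √3)`      (`= (sinh² w + sin²(3γ/4))/(sinh² w + sin²(γ/4))`),
the GROUND-STATE Bethe equations of the sector with `M` roots are
  `N·F(w_j) - Σ_{l ≠ j} [G(w_j - w_l) + G(w_j + w_l)] = π·j`,  `j = 1, …, M`,  `0 < w_1 < ⋯ < w_M`,
and `Λ_n(w) = 2^{-(2n+1)} ∏_j f(w_j)`; the sector `M = n+1-k` is the TL standard module `W_{2k}`: `k = 0` stationary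
(`Λ = 1` EXACTLY), `k = 1` the marked block (`Λ =` escape modulus), `k = 2` (`Λ =` SLEM of the unmarked block).
Re-validated by this seat (`compute/bae.py`, pure python, Newton): for `n ≤ 6`, `k = 0, 1, 2` the product reproduces
`1`, the escape moduli `0.654508497187, 0.737999068548, …` and the SLEMs `0.125, 0.199133791352, …` of the exact
chain to `5e-13`; the Hessian of the Yang–Yang function at the solution is positive definite (min eigenvalue
`≈ 13.3` for `k = 1`, `≈ 25` for `k = 2`), multistart Newton (300 ordered positive starts, `n ≤ 4`) finds ONE solution.

K is accordingly reshaped (same composition, through the landed Reduction `stripClusterRates_of_kacGapAsymptotics`)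
into the three pillars of a rigorous Bethe-ansatz proof, five registered stubs:
* BX  `stub_betheGroundExists` (L, PROVABLE NOW) — for `2M ≤ N` an ordered positive solution EXISTS. Proof route
  (Brouwer-free): `|G| < π/6` and `F : ℝ ≃o (-2π/3, 2π/3)`, so `Φ_j(w) := F⁻¹((πj + Σ_{l≠j}[G(w_j-w_l)+G(w_j+w_l)])/N)`
  maps the compact convex set `C = {0 ≤ w_1 ≤ ⋯ ≤ w_M ≤ B}` (`F(B) = π(4M-1)/(3N) < 2π/3`) into itself, strictly
  inside the order cone; the Yang–Yang function `S(w) = Σ_j [N·IF(w_j) - πj·w_j] - ½Σ_{j≠l}[IG(w_j-w_l) + IG(w_j+w_l)]`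
  (`IF' = F`, `IG' = G`, interval integrals) is `C¹` with `∂_j S(w) = N·(F(w_j) - F(Φ_j(w)))`; at a minimiser `w⋆` of
  `S` on `C` the one-variable function `t ↦ S(w⋆ + t(Φ(w⋆) - w⋆))` on `[0,1]` has a minimum at `0`, so
  `Σ_j N (F(w⋆_j) - F(Φ_j))(Φ_j - w⋆_j) ≥ 0`, every summand being `≤ 0` (F increasing) — hence `Φ(w⋆) = w⋆`.
* BI₁ `stub_escapeIsBethe` (XL) — for `n ≥ 1` the escape modulus of width `n` equals `Λ_n(w)` at every ground-state
  solution with `M = n` (algebraic Bethe ansatz for the open staggered transfer matrix, Sklyanin 1988 /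
  Yung–Batchelor 1995 eq. (3.x): `Λ` is the eigenvalue of the Bethe vector; Perron identification in `W₂`;
  uniqueness of the ground-state solution). Numerically exact for `n ≤ 12`.
* BI₂ `stub_relaxIsBethe` (XL) — the same for the relaxation modulus, `M = n - 1` (`n = 1`: empty product,
  `Λ = 1/8 = SLEM(1)`, cf. `Negative.rateTwo_width_one`).
* BA₁ `stub_betheKacOne` (open core, the lead's) — along ANY family of ground-state solutions with `M = n`,
  `n·(-log Λ_n) → π/3` (finite-size analysis of the staggered kernel: root density
  `ρ`, `F' - (G'∗ρ)(· ∓ ·) = πρ`, Euler–Maclaurin + Wiener–Hopf at the two Fermi ends / de Vega–Woynarovich,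
  Hamer–Quispel–Batchelor 1987 for the homogeneous open chain; numerically `n·γ₁(n) = π/3 · n/(n + 1.354 + O(1/n))`,
  8 digits at `n = 4096`).
* BA₂ `stub_betheKacTwo` (open core, HARDEST) — the same with `M = n - 1`, limit `2π`.
Composition: BX gives a solution family `w n`, BI identifies `r n = Λ_n(w n)` for `n ≥ 1`, BA gives the limit
(`Tendsto.congr'`); then the landed Reduction. -/

/-! ## Progress note by the continuation lead c2 (prover-line-stmt-CriticalPhenomena-13878-c2-0, 2026-08-16)

No reshape: the registered stubs stay BP₁ `stub_bethePositiveVectorOne`, BI₂ `stub_relaxIsBethe`, BA₁ `stub_betheKacOne`,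
BA₂ `stub_betheKacTwo` (skeleton check OK under c2, 18:45Z).  What this tenure adds towards BA₁/BA₂ (all LANDED as `--supports`
helpers in this namespace, wave 2):
* `bu_kernel_partialFraction` (p121350) — Mittag-Leffler expansion of the scattering kernel
  `G'(x) = (√3/2)/(cosh 2x + 1/2) = Σ_{n≥0} [a_n/(x²+a_n²) − b_n/(x²+b_n²)]`, `a_n = π/3+πn`, `b_n = 2π/3+πn`;
* `bu_lorentzPair_posSemidef` (p121630) — each paired Lorentzian (`0 < a ≤ b`) is a positive-semidefinite kernel (Fourier);
* `bu_kernel_posSemidef` (p121757) — hence `G'` IS POSITIVE-SEMIDEFINITE (Bochner; `Ĝ'(ω) = π/(1+2cosh(πω/3))`): the structural fact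
  behind convexity of the Yang–Yang action, uniqueness and condensation of the roots (diagonal dominance FAILS in the tail by a factor 2);
* `bu_betheMap_injOn` (p122287) — the Bethe map `w ↦ (N F(w_j) − Σ_{l≠j}[G(w_j−w_l)+G(w_j+w_l)])_j` is INJECTIVE on every convex set
  where the diagonal Yang–Yang coefficient `c_j = N F'(w_j) − Σ_{l≠j}[G'(w_j−w_l)+G'(w_j+w_l)] − G'(0) + G'(2w_j)` is positive
  (image-charge decomposition `dᵀDΦ d = Σ c_j d_j² + ½Σ_{±}G'(P_J−P_L)Y_JY_L`): uniqueness of ground-state roots in good regions.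
ANALYTIC BLUEPRINT of BA (crux workfile `Lines/two-cluster-rate-is-stationary-gap-BA-blueprint.md`): the thermodynamics of the
staggered open chain is closed-form — `ρ̂(ω) = cosh(πω/12)/cosh(πω/6)`, `ρ(x) = (3√2/π)cosh 3x/cosh 6x`, resolvent `R̂ = 1/(4cosh²(πω/6))`,
dressed energy `ε̂(ω) = 2π sinh(πω/12)/(ω cosh(πω/6))` (dressing kills the `e^{-2x}` tail of `ε₀ = log f`; `ε, ρ ≍ e^{-3x}`: relativistic
edge, level-spacing unit exactly `2π/N`), bulk and surface sum rules `e_∞ = f_∞ = 0` (checked to 1e-12), and the open-chain dressed-charge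
formula gives `E_k(n) = (2π/N)[(k − 1/4)²/(2ξ²) − 1/24] + o(1/N)` with `ξ² = 1/(1+Ĝ'(0)/π) = 3/4` (kernel mass 1/3) and boundary shift
`1/4 = ½·` dressed mass of the self-image + origin-hole phases — i.e. `h_k = k(2k−1)/3 = 0, 1/3, 2, 5`, exactly the Kac table `h_{1,2k+1}`.
Wave 3 (condensation building blocks, blueprint L4; all LANDED): `bu_gap_lower` (p122918: consecutive roots are more than one
quantum apart, `N·(F(w_{j+1}) − F(w_j)) > π`, with the exact gap identity `bu_gap_identity`), `bu_gap_upper_local` (p123080: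
`N·ΔF ≤ 4π/3 + (2(M−2)/√3)·Δw`), `bu_kernel_integral` (p123240: `∫G' = π/3`, integrable, positive — the `L^∞`-contraction constant `1/3`
of the linearised equations), `bu_F_secant_bounds` (p123328: `(b−a)F'(b) ≤ F(b)−F(a) ≤ (b−a)F'(a)` on `[0,∞)`).  Numerics (kit j019495,
n ≤ 8192): the Yang–Yang Hessian at the solution is positive-definite with an n-INDEPENDENT margin 2.4253 / 13.151 / 24.003 / 34.871
(k = 0/1/2/3, n ≤ 1024), the top-root pattern converges (L5), `n·E_k(n)` ↑ `π h_k` with `1/E_k ≈ (n + 1.3535)/(π h_k)`.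
Wave 4 (LANDED): `bu_escaping_index` (p123702: a root beyond `Λ` has index `j+1 > N F(Λ)/π − (M−1)/3` — Kozlowski 2018 Prop. 2.3 analogue)
and `bu_kernel_conv_bound` (p123842: `|∫ G'(x−y)u(y)dy/π| ≤ sup|u|/3`).  CALIBRATION (arXiv:1508.05741, read this cycle): even for the periodic XXZ
chain the `O(1/L)` term of the counting function is proved only for compact Fermi zones; at half filling (our non-compact situation) only `o(1)` is
rigorous — BA₁/BA₂ ask for new rigorous mathematics, see the blueprint §5.
What remains OPEN is the rigorous finite-size control (condensation with `O(1/N)` bulk accuracy + the Wiener–Hopf edge limit) — blueprint §5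
lists the lemma chain L4–L7; BP₁/BI₂ remain blocked on the open-chain algebraic Bethe ansatz + Perron positivity (no tree / print fact). -/

/-! ### Bethe vocabulary (readable local names; the registered stubs inline them) -/

/-- Bethe momentum phase of the staggered open chain at `γ = π/3`:
`F(w) = arctan((2+√3)·tanh w) + arctan(tanh w)` (`cot(π/12) = 2+√3`, `cot(π/4) = 1`). -/
def betheF (w : ℝ) : ℝ := Real.arctan ((2 + Real.sqrt 3) * Real.tanh w) + Real.arctan (Real.tanh w)

/-- Bethe scattering phase `G(x) = arctan(tanh x/√3)` (`cot(π/3) = 1/√3`). -/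
def betheG (x : ℝ) : ℝ := Real.arctan (Real.tanh x / Real.sqrt 3)

/-- One-root eigenvalue factor `f(w) = (4 sinh² w + 2)/(4 sinh² w + 2 - √3)` (`sin²(π/4) = 1/2`,
`sin²(π/12) = (2-√3)/4`). -/
def bethef (w : ℝ) : ℝ := (4 * Real.sinh w ^ 2 + 2) / (4 * Real.sinh w ^ 2 + 2 - Real.sqrt 3)

/-- The Bethe eigenvalue of width `n` (i.e. `N = 2n+2` strands) at roots `w`: `Λ_n(w) = 2^{-(2n+1)} ∏_j f(w_j)`. -/
def betheLambda (n : ℕ) {M : ℕ} (w : Fin M → ℝ) : ℝ := (∏ j, bethef (w j)) / 2 ^ (2 * n + 1)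

/-- Ground-state Bethe equations with `N` strands and `M` roots (quantum numbers `J_j = j`, here `j+1` for
`j : Fin M`): ordered positive roots with `N·F(w_j) - Σ_{l ≠ j} [G(w_j - w_l) + G(w_j + w_l)] = π·(j+1)`. -/
def IsGroundBethe (N M : ℕ) (w : Fin M → ℝ) : Prop :=
  StrictMono w ∧ (∀ j, 0 < w j) ∧
    ∀ j : Fin M, (N : ℝ) * betheF (w j) -
      ∑ l ∈ Finset.univ.erase j, (betheG (w j - w l) + betheG (w j + w l)) = Real.pi * ((j : ℕ) + 1)

/-! ### Named statements of the Bethe stubs -/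

/-- BX · existence of the ordered positive ground-state solution for `2M ≤ N`. -/
def BetheGroundExists : Prop := ∀ N M : ℕ, 2 * M ≤ N → ∃ w : Fin M → ℝ, IsGroundBethe N M w

/-- BI₁ · the escape modulus of width `n ≥ 1` is the Bethe eigenvalue of the `M = n` ground state. -/
def EscapeIsBethe : Prop :=
  ∀ n : ℕ, 1 ≤ n → ∀ r : ℝ, IsEscapeModulus n r → ∀ w : Fin n → ℝ, IsGroundBethe (2 * n + 2) n w →
    r = betheLambda n w

/-- BP₁ · POSITIVE BETHE EIGENVECTOR of the marked block (the weakest form of the identification input, after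
wave 1): for every ordered positive ground-state solution with `M = n` the marked block of `planarTransfer (cols n)`
has an eigenvector, strictly positive on marked patterns and zero on unmarked ones, with eigenvalue `Λ_n(w)`. -/
def BethePositiveVectorOne : Prop :=
  ∀ n : ℕ, 1 ≤ n → ∀ w : Fin n → ℝ, IsGroundBethe (2 * n + 2) n w →
    ∃ v : PlanarRowState (cols n) → ℝ,
      (∀ p, (∃ x, p.1.JoinedToStar x) → 0 < v p) ∧ (∀ p, (∀ x, ¬ p.1.JoinedToStar x) → v p = 0) ∧
        ∀ p, (∃ x, p.1.JoinedToStar x) → ∑ q, planarTransfer (cols n) p q * v q = betheLambda n w * v p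

/-- BI₂ · the relaxation modulus of width `n ≥ 1` is the Bethe eigenvalue of the `M = n-1` ground state. -/
def RelaxIsBethe : Prop :=
  ∀ n : ℕ, 1 ≤ n → ∀ s : ℝ, IsRelaxationModulus n s → ∀ w : Fin (n - 1) → ℝ,
    IsGroundBethe (2 * n + 2) (n - 1) w → s = betheLambda n w

/-- BA₁ · Kac asymptotics of the `M = n` Bethe eigenvalue: `n·(-log Λ_n) → π/3 = π·h_{1,3}`. -/
def BetheKacOne : Prop :=
  ∀ w : (n : ℕ) → (Fin n → ℝ), (∀ n : ℕ, 1 ≤ n → IsGroundBethe (2 * n + 2) n (w n)) →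
    Tendsto (fun n : ℕ ↦ (n : ℝ) * -Real.log (betheLambda n (w n))) atTop (𝓝 (Real.pi / 3))

/-- BA₂ · Kac asymptotics of the `M = n-1` Bethe eigenvalue: `n·(-log Λ_n) → 2π = π·h_{1,5}`. -/
def BetheKacTwo : Prop :=
  ∀ w : (n : ℕ) → (Fin (n - 1) → ℝ), (∀ n : ℕ, 1 ≤ n → IsGroundBethe (2 * n + 2) (n - 1) (w n)) →
    Tendsto (fun n : ℕ ↦ (n : ℝ) * -Real.log (betheLambda n (w n))) atTop (𝓝 (2 * Real.pi))

/-! ### Registered Bethe stubs (`sorry` lives only here; statements inline the Bethe vocabulary and the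
eigenpair / modulus predicates over tree vocabulary) -/

-- stub_betheGroundExists (BX): LANDED p100287 (imported from Theorems/CardyBoundaryCoulombGasStripClusterRatesStubBetheGroundExists.lean;
-- wave 1 of lead c1, 323 lines, with the Bethe kernel toolkit p98161 and the root window p99471).

-- stub_relaxIsBethe (BI₂) and stub_betheKacTwo (BA₂): DEMOTED by reshape 4 (lead c4, below) from registered `sorry`
-- stubs to hypotheses of the proved implication `relaxationRateKac_of_bethe : BetheGroundExists → RelaxIsBethe →
-- BetheKacTwo → RelaxationRateKac` (their statements are the named `def`s `RelaxIsBethe`, `BetheKacTwo` above; their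
-- registered signatures stay on the item for any future Bethe worker).

/-! ## Reshape 3 by the continuation lead c3 (prover-line-stmt-CriticalPhenomena-13878-c3-0, 2026-08-16):
the γ₁-half onto crux 4

c2's census: all four Bethe stubs are blocked on mathematics absent from the tree AND from print (BP₁/BI₂: open-chain
algebraic Bethe ansatz + Perron identification of the `J_j = j` state; BA₁/BA₂: the `O(1/N)` term of a Bethe system with a
NON-COMPACT Fermi edge). The γ₁-half has a second, item-backed route, built by the parallel lead -1
(prover-line-stmt-CriticalPhenomena-13878-1) and LANDED except for its last implication:
* `stub_sandwichUpper` (p96945) — FKG/RSW gluing: `γ₁(n) ≤ (log 2 − log p₁(m,n))/(m − n)` for `m > n`;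
* `stub_lamRLog` (p97023) — `log λ(it)/t → −π` (Kleban–Zagier `lamR`, theta functions);
* `stub_cardyLog` (p96855) — `log F(η)/log η → 1/3` at `0⁺` (`cardyFunction`);
* `stub_composeOne` (p97101) — sandwich (upper from the three above, lower from the landed sub-multiplicativity
  `Negative.SubmultiplicativeOne`) ⇒ (`stub_rectCardyOne` ⇒ `n·γ₁(n) → π/3` for EVERY family of one-cluster rates);
* `stub_rectCardyOne` (OPEN; registered by lead -1, re-registered by c1) — Cardy's value for the lattice rectangles:
  `crossingProb half (A·k−2) (k−2) → F(λ(iA))` as `k → ∞`, for every integer aspect `A ≥ 1`.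
`stub_rectCardyOne` is a COROLLARY of crux 4 `RectilinearCardy` (stmt-CriticalPhenomena-5660, an existing route item):
the registered implication `rc_rectCardyOne_of_rectilinearCardy` (lead -1, parts 1/2a landed: `RectBox.meshDomain_obox` p98076,
`RectBox.discreteArc_left` p100407) is COMPLETED by this tenure's wave 1 (all LANDED) — (i) `rc_exists_boxRect` (p124868): the
Bollobás–Riordan box `brRect A 1` of the crux-4 Negative file has carrier `(0,A)×(0,1)`, arcs `0`/`2` = left/right sides, corner
marks `i, 0, A, A+i` and a rectilinear frontier; (ii) `rc_box_dictionary` (p125077): the event dictionary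
`bondDomainCrossingProb R (1/k) = crossingProb half (A·k−2) (k−2)` for any such `R` (discrete arcs = first/last column, `Ω_δ` = the
lattice box, translation by `(1,1)`, `bondPercolation_real_lrCrossingAt`); (iii) `rc_rectCardyOne_of_parts` (p125211): assembly
through `rectangle_crossRatio_eq_lamR` (the modulus of the box is `λ(iA)` for EVERY uniformizing datum) and
`exists_isUniformizing_holds`, composing `δ ↦ p(δ)` with `k ↦ 1/k → 0⁺`; glue `rc_rectCardyOne_of_rectilinearCardy` and the corollary
`oneClusterKac_of_rectilinearCardy : RectilinearCardy → ∀ γ₁ rates, n·γ₁(n) → π/3` in `…RectCardyOneOfRectilinearCardy.lean` (p125448).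
So the skeleton now has THREE registered open stubs: `stub_rectCardyOne` (⟸ crux 4), `stub_relaxIsBethe` (BI₂),
`stub_betheKacTwo` (BA₂, lead-held); the Bethe γ₁ pair BP₁/BA₁ is kept as NAMED STATEMENTS only (their closure of the crux is
the landed `stripClusterRates_of_bethePillars`, p103356, last `example` of the file). Two further LANDED structure theorems
(lead c3): `twoClusterKac_iff_kacTwo` (p125671, file `…TwoClusterKacIffKacTwo`): the γ₂-conjunct of the crux, for every
family of two-cluster rates, is EQUIVALENT to K₂ = `RelaxationRateKac` (= lead -1's `stub_kacTwo`); and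
`stripClusterRates_of_rectilinearCardy_of_kacTwo` (p125718, file `…OfRectilinearCardy`): the crux from crux 4 and K₂ alone.
Net state: StripClusterRates ⟸ RectilinearCardy ∧ K₂, K₂ ⟺ γ₂-conjunct, K₂ ⟸ BI₂ ∧ BA₂ — everything in the crux beyond
crux 4 is the `h_{1,5} = 2` gap of the two-cluster sector. -/

/-- RC₁ · CARDY'S VALUE FOR THE LATTICE RECTANGLES (γ₁ stub of reshape 3; lead -1's `stub_rectCardyOne`): for every
integer aspect `A ≥ 1`, `P_{1/2}[LR crossing of [0, A·k−2] × [0, k−2]] → F(λ(iA))` as `k → ∞` (`F = cardyFunction`,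
`λ(iA) = KlebanZagier.lamR A` the modulus of the `A × 1` rectangle). OPEN (it is Cardy's formula for rectangles of
rational aspect ratio, Schramm's Problem 2.11); implied by crux 4 `RectilinearCardy` (`rc_rectCardyOne_of_rectilinearCardy`).
[CardyJPhysA1992; KlebanZagier2003 §3; BollobasRiordan2006 Ch. 7 §7.1; Smirnov2001 Thm 1 (triangular lattice)] -/
def RectCardyOne : Prop :=
  ∀ A : ℕ, 1 ≤ A → Tendsto (fun k : ℕ ↦ crossingProb half (A * k - 2) (k - 2)) atTop
    (𝓝 (Literature.Probability.RandomPlanarGeometry.cardyFunction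
      (Literature.Probability.RandomPlanarGeometry.KlebanZagier.lamR A)))

-- stub_rectCardyOne (RC₁ = `RectCardyOne`): DEMOTED by reshape 6 (lead c7, below) from registered `sorry` to a NAMED
-- STATEMENT; the γ₁ input of the composition is now the WEAKER Cardy-order statement CO₁ (`stub_cardyOrderOne`), which RC₁
-- implies (`cardyOrderOne_of_rectCardyOne`, landed) and which is NECESSARY for the crux (`cardyOrderOne_of_stripClusterRates`).

/-- **RC₁ from crux 4** (the three LANDED parts composed; the same term is the landed glue
`rc_rectCardyOne_of_rectilinearCardy`, p125448): Cardy's formula for rectilinear conformal rectangles gives Cardy's value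
for the lattice rectangles. -/
theorem rectCardyOne_of_rectilinearCardy
    (h₄ : Summit.CriticalPhenomena.CardyFormulaZ2.Theses.CardyBoundaryCoulombGas.RectilinearCardy) : RectCardyOne :=
  rc_rectCardyOne_of_parts rc_exists_boxRect rc_box_dictionary h₄

/-! ## Reshape 4 by the continuation lead c4 (prover-line-stmt-CriticalPhenomena-13878-c4-0, 2026-08-16):
two stubs, RC₁ ∧ K₂ — the item-level shape

Census of c1–c3, confirmed by this tenure: BI₂ (open-chain algebraic Bethe ansatz + Perron identification in `W₄`, absent
from tree and print) and BA₂ (the `O(1/N)` term of the staggered open Bethe system at a NON-COMPACT Fermi edge, open in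
print even for homogeneous periodic chains, Kozlowski 2018 Thm 3.5) are not worker-sized; their conjunction is used ONLY
through K₂ = `RelaxationRateKac` (`relaxationRateKac_of_bethe`). Reshape 4 therefore registers K₂ itself as the γ₂ stub
(`stub_kacTwo`, lead -1's registered statement, verbatim) and keeps the Bethe pair as a PROVED IMPLICATION
(`relaxationRateKac_of_bethe`, hypotheses `RelaxIsBethe`, `BetheKacTwo`), so that the skeleton has exactly the two stubs
an item can discharge:
* RC₁ `stub_rectCardyOne` ⟸ `CardyRectangle` (stmt-CriticalPhenomena-4782, shared with route `CardyPolygonWords`: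
  Cardy for corner-marked rectangles; LANDED `rc_rectCardyOne_of_cardyRectangle`, p126652) ⟸ crux 4 `RectilinearCardy`
  (stmt-5660; LANDED `cardyRectangle_of_rectilinearCardy`, p126652) ⟸ the conjunct `CardyFormulaZ2`
  (LANDED `rectilinearCardy_of_cardyFormulaZ2`, p126523) — so the γ₁-half of the crux is a COROLLARY OF THE CONJUNCT;
* K₂ `stub_kacTwo` — `n·(−log SLEM of the unmarked block of planarTransfer (Icc 0 n)) → 2π`; NECESSARY
  (`kacTwo_of_stripClusterRates`, p126523: the crux implies K₂ unconditionally) and, given the conjunct, SUFFICIENT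
  (`stripClusterRates_iff_kacTwo_of_cardyFormulaZ2`, p126523). Open problem (Cardy 1998 eq. (bb), n = 2, transfer-matrix
  order); only known decomposition BI₂ ∧ BA₂ (this file) — numerically exact (BI₂ to 12 digits, n ≤ 12; BA₂ to 8 digits,
  n ≤ 4096; DREFUTE-r4).
Net: `StripClusterRates ⟺ (γ₁-half) ∧ K₂`, `(γ₁-half) ⟸ CardyRectangle ⟸ RectilinearCardy ⟸ CardyFormulaZ2`. -/

-- stub_kacTwo (K₂ = `RelaxationRateKac`, lead -1's registered statement): DEMOTED by reshape 5 (lead c6, below) from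
-- registered `sorry` to a NAMED STATEMENT; the γ₂-half is now derived from the Cardy-order stub `stub_cardyOrderTwo`
-- through the confined-gluing order transfer, and K₂ follows from it (`kacTwo_of_cardyOrderTwo`).

/-- **RC₁ from `CardyRectangle`** (stmt-CriticalPhenomena-4782; the landed `rc_rectCardyOne_of_cardyRectangle`, p126652). -/
theorem rectCardyOne_of_cardyRectangle
    (h : Summit.CriticalPhenomena.CardyFormulaZ2.Theses.CardyPolygonWords.CardyRectangle) : RectCardyOne :=
  rc_rectCardyOne_of_cardyRectangle h

/-- **RC₁ from the conjunct** (`CardyFormulaZ2 → RectilinearCardy → CardyRectangle → RC₁`, all landed, p126523/p126652). -/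
theorem rectCardyOne_of_cardyFormulaZ2 (h : _root_.CardyFormulaZ2) : RectCardyOne :=
  rectCardyOne_of_cardyRectangle (cardyRectangle_of_rectilinearCardy (rectilinearCardy_of_cardyFormulaZ2 h))

/-! ### Consistency of the Bethe stubs with their named statements (definitional) -/

theorem betheGroundExists_holds : BetheGroundExists := fun N M h => stub_betheGroundExists N M h

/-- **Collatz–Wielandt step** (copy of the landed helper `bi1_escapeModulus_of_positiveVector`,
`Theorems/CardyBoundaryCoulombGasStripClusterRatesEscapeOfPositiveVector.lean`, p101625, kept here so that the
skeleton elaborates before that file is built): a strictly positive eigenvector of the marked block with eigenvalue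
`λ > 0` makes `λ` the escape modulus. -/
theorem sk_escapeModulus_of_positiveVector (n : ℕ) (lam : ℝ) (v : PlanarRowState (cols n) → ℝ) (hlam : 0 < lam)
    (hpos : ∀ p, (∃ x, p.1.JoinedToStar x) → 0 < v p) (hzero : ∀ p, (∀ x, ¬ p.1.JoinedToStar x) → v p = 0)
    (heig : ∀ p, (∃ x, p.1.JoinedToStar x) → ∑ q, planarTransfer (cols n) p q * v q = lam * v p) :
    IsEscapeModulus n lam := by
  have hT0 : ∀ p q : PlanarRowState (cols n), 0 ≤ planarTransfer (cols n) p q :=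
    fun p q => s1_planarTransfer_nonneg _ p q
  have hwired : ∃ x, (PlanarRowState.wired (cols n)).1.JoinedToStar x :=
    ⟨⟨0, by simp⟩, s1_joinedToStar_wired _⟩
  refine ⟨⟨(lam : ℂ), fun p => (v p : ℂ), ⟨?_, ?_, ?_⟩, ?_⟩, ?_⟩
  · intro h
    have h1 := congrFun h (PlanarRowState.wired (cols n))
    have h2 := hpos _ hwired
    simp only [Pi.zero_apply, Complex.ofReal_eq_zero] at h1
    exact h2.ne' h1
  · intro p hp
    simp only [hzero p hp, Complex.ofReal_zero]
  · intro p hp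
    have h := heig p hp
    have e : ∑ q, (planarTransfer (cols n) p q : ℂ) * (v q : ℂ) =
        ((∑ q, planarTransfer (cols n) p q * v q : ℝ) : ℂ) := by
      push_cast
      rfl
    rw [e, h]
    push_cast
    rfl
  · simp [abs_of_pos hlam]
  · rintro μ u ⟨hu0, huz, hueig⟩
    obtain ⟨p₀, hp₀⟩ : ∃ p, u p ≠ 0 := by
      by_contra h
      push Not at h
      exact hu0 (funext h)
    have hp₀m : ∃ x, p₀.1.JoinedToStar x := by
      by_contra h
      push Not at h
      exact hp₀ (huz p₀ h)
    obtain ⟨pm, -, hpm⟩ := Finset.exists_max_image (Finset.univ : Finset (PlanarRowState (cols n)))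
      (fun p => ‖u p‖ / v p) ⟨p₀, Finset.mem_univ _⟩
    have hc0 : 0 < ‖u pm‖ / v pm := by
      have h1 : 0 < ‖u p₀‖ / v p₀ := div_pos (norm_pos_iff.2 hp₀) (hpos p₀ hp₀m)
      exact h1.trans_le (hpm p₀ (Finset.mem_univ _))
    have hvpm : 0 < v pm := by
      by_contra h
      have hle : v pm ≤ 0 := not_lt.1 h
      have : ‖u pm‖ / v pm ≤ 0 := div_nonpos_of_nonneg_of_nonpos (norm_nonneg _) hle
      linarith
    have hpmm : ∃ x, pm.1.JoinedToStar x := by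
      by_contra h
      push Not at h
      have := hzero pm h
      linarith
    have hupm : 0 < ‖u pm‖ := by
      have e : ‖u pm‖ = ‖u pm‖ / v pm * v pm := by rw [div_mul_cancel₀ _ hvpm.ne']
      rw [e]
      positivity
    have hcmp : ∀ q, ‖u q‖ ≤ ‖u pm‖ / v pm * v q := by
      intro q
      by_cases hq : ∃ x, q.1.JoinedToStar x
      · exact (div_le_iff₀ (hpos q hq)).1 (hpm q (Finset.mem_univ _))
      · push Not at hq
        rw [huz q hq, hzero q hq, norm_zero, mul_zero]
    have key : ‖μ‖ * ‖u pm‖ ≤ lam * ‖u pm‖ := by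
      calc ‖μ‖ * ‖u pm‖ = ‖μ * u pm‖ := (norm_mul _ _).symm
        _ = ‖∑ q, (planarTransfer (cols n) pm q : ℂ) * u q‖ := by rw [hueig pm hpmm]
        _ ≤ ∑ q, ‖(planarTransfer (cols n) pm q : ℂ) * u q‖ := norm_sum_le _ _
        _ = ∑ q, planarTransfer (cols n) pm q * ‖u q‖ := by
            refine Finset.sum_congr rfl fun q _ => ?_
            rw [norm_mul, Complex.norm_real, Real.norm_eq_abs, abs_of_nonneg (hT0 pm q)]
        _ ≤ ∑ q, planarTransfer (cols n) pm q * (‖u pm‖ / v pm * v q) :=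
            Finset.sum_le_sum fun q _ => mul_le_mul_of_nonneg_left (hcmp q) (hT0 pm q)
        _ = ‖u pm‖ / v pm * ∑ q, planarTransfer (cols n) pm q * v q := by
            rw [Finset.mul_sum]
            refine Finset.sum_congr rfl fun q _ => ?_
            ring
        _ = ‖u pm‖ / v pm * (lam * v pm) := by rw [heig pm hpmm]
        _ = lam * (‖u pm‖ / v pm * v pm) := by ring
        _ = lam * ‖u pm‖ := by rw [div_mul_cancel₀ _ hvpm.ne']
    exact le_of_mul_le_mul_right key hupm

/-- **BI₁ from BP₁**: the escape modulus is unique (landed `bi_escapeModulus_unique`) and `Λ_n(w) > 0` (landed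
toolkit `bk_betheLambda_pos`) is an escape modulus by the Collatz–Wielandt step. -/
theorem escapeIsBethe_of_positiveVector (hP : BethePositiveVectorOne) : EscapeIsBethe := by
  intro n hn r hr w hw
  obtain ⟨v, hvpos, hvzero, hveig⟩ := hP n hn w hw
  have hlam : 0 < betheLambda n w := bk_betheLambda_pos n w
  exact bi_escapeModulus_unique n r _ hr (sk_escapeModulus_of_positiveVector n _ v hlam hvpos hvzero hveig)


/-- **K from the Bethe pillars.** BX gives a family of ground-state solutions, BI identifies the moduli with the
Bethe eigenvalue for `n ≥ 1`, BA gives the limits. -/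
theorem kacGapAsymptotics_of_bethe (hX : BetheGroundExists) (hI₁ : EscapeIsBethe) (hI₂ : RelaxIsBethe)
    (hA₁ : BetheKacOne) (hA₂ : BetheKacTwo) : KacGapAsymptotics := by
  constructor
  · intro r hr
    have hex : ∀ n : ℕ, ∃ w : Fin n → ℝ, IsGroundBethe (2 * n + 2) n w := fun n => hX _ _ (by omega)
    choose w hw using hex
    refine (hA₁ w fun n _ => hw n).congr' ?_
    filter_upwards [eventually_ge_atTop 1] with n hn
    rw [hI₁ n hn (r n) (hr n hn) (w n) (hw n)]
  · intro s hs
    have hex : ∀ n : ℕ, ∃ w : Fin (n - 1) → ℝ, IsGroundBethe (2 * n + 2) (n - 1) w :=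
      fun n => hX _ _ (by omega)
    choose w hw using hex
    refine (hA₂ w fun n _ => hw n).congr' ?_
    filter_upwards [eventually_ge_atTop 1] with n hn
    rw [hI₂ n hn (s n) (hs n hn) (w n) (hw n)]

/-- **S4 from the γ₂ Bethe pair** (reshape 3): BX (landed) gives the `M = n-1` ground-state family, BI₂ identifies
the relaxation modulus with its Bethe eigenvalue, BA₂ gives the limit `2π`. -/
theorem relaxationRateKac_of_bethe (hX : BetheGroundExists) (hI₂ : RelaxIsBethe) (hA₂ : BetheKacTwo) :
    RelaxationRateKac := by
  intro s hs
  have hex : ∀ n : ℕ, ∃ w : Fin (n - 1) → ℝ, IsGroundBethe (2 * n + 2) (n - 1) w :=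
    fun n => hX _ _ (by omega)
  choose w hw using hex
  refine (hA₂ w fun n _ => hw n).congr' ?_
  filter_upwards [eventually_ge_atTop 1] with n hn
  rw [hI₂ n hn (s n) (hs n hn) (w n) (hw n)]

-- `relaxationRateKac_holds` is re-derived below (reshape 5) from `stub_cardyOrderTwo`.

/-! ### Consistency: each named statement IS its registered stub (definitionally) -/

theorem oneClusterDictionary_holds : OneClusterDictionary := fun m n => stub_oneClusterDictionary m n
theorem planarReachable_holds : PlanarReachable := stub_planarReachable
theorem oneClusterSpectral_holds : OneClusterSpectral := fun h₁ h₂ n hn => stub_oneClusterSpectral h₁ h₂ n hn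
theorem twoClusterDictionary_holds : TwoClusterDictionary := fun n hn => stub_twoClusterDictionary n hn
theorem relaxationUpper_holds : RelaxationUpper := fun n hn => stub_relaxationUpper n hn
theorem relaxationLower_holds : RelaxationLower := fun n hn μ v h h1 => stub_relaxationLower n hn μ v h h1
-- `rectCardyOne_holds` no longer exists (reshape 6): RC₁ is strictly stronger than the registered γ₁ stub CO₁.

/-! ### Name-keyed aliases of the seven statements (the hypotheses of the composition) -/
namespace Registered

/-- Alias of `OneClusterDictionary` keyed by the registered stub name. -/
abbrev stub_oneClusterDictionary : Prop := OneClusterDictionary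
/-- Alias of `PlanarReachable` keyed by the registered stub name. -/
abbrev stub_planarReachable : Prop := PlanarReachable
/-- Alias of `OneClusterSpectral` keyed by the registered stub name. -/
abbrev stub_oneClusterSpectral : Prop := OneClusterSpectral
/-- Alias of `TwoClusterDictionary` keyed by the registered stub name. -/
abbrev stub_twoClusterDictionary : Prop := TwoClusterDictionary
/-- Alias of `RelaxationUpper` keyed by the registered stub name. -/
abbrev stub_relaxationUpper : Prop := RelaxationUpper
/-- Alias of `RelaxationLower` keyed by the registered stub name. -/
abbrev stub_relaxationLower : Prop := RelaxationLower
/-- Alias of `RelaxIsBethe` keyed by the registered stub name. -/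
abbrev stub_relaxIsBethe : Prop := RelaxIsBethe
/-- Alias of `BetheKacTwo` keyed by the registered stub name. -/
abbrev stub_betheKacTwo : Prop := BetheKacTwo
/-- Alias of `RectCardyOne` keyed by the (reshape 3–5) stub name; since reshape 6 a named statement only. -/
abbrev stub_rectCardyOne : Prop := RectCardyOne
/-- Alias of `RelaxationRateKac` (K₂) keyed by the registered stub name. -/
abbrev stub_kacTwo : Prop := RelaxationRateKac

end Registered

/-! ## Proved glue (kernel-checked; nothing is admitted below this line) -/

/-- `n · -log (e^{-γ}) = n · γ`. -/
theorem mul_neg_log_exp_neg (n γ : ℝ) : n * -Real.log (Real.exp (-γ)) = n * γ := by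
  rw [Real.log_exp, neg_neg]

/-- **Rates from two-sided geometric bounds.** If `0 < a m`, `c s^m ≤ a m` for some `c > 0`, and
`a m ≤ C_{s'} s'^m` for every `s' > s > 0`, then `-log (a m)/m → -log s`. -/
theorem tendsto_rate_of_geometric_bounds {a : ℕ → ℝ} {s : ℝ} (hs : 0 < s) (ha : ∀ m, 0 < a m)
    (hlow : ∃ c : ℝ, 0 < c ∧ ∀ m, c * s ^ m ≤ a m)
    (hup : ∀ s' : ℝ, s < s' → ∃ C : ℝ, ∀ m, a m ≤ C * s' ^ m) :
    Tendsto (fun m : ℕ => -Real.log (a m) / (m : ℝ)) atTop (𝓝 (-Real.log s)) := by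
  rw [tendsto_order]
  constructor
  · -- lower estimate: eventually `b < -log (a m) / m` for every `b < -log s`
    intro b hb
    set b' : ℝ := (b + -Real.log s) / 2 with hb'
    have hbb' : b < b' := by rw [hb']; linarith
    have hb's : b' < -Real.log s := by rw [hb']; linarith
    obtain ⟨C, hC⟩ := hup (Real.exp (-b')) (by
      calc s = Real.exp (Real.log s) := (Real.exp_log hs).symm
        _ < Real.exp (-b') := Real.exp_lt_exp.2 (by linarith))
    have hC0 : 0 < C := by
      have h0 := hC 0
      simp only [pow_zero, mul_one] at h0
      exact (ha 0).trans_le h0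
    -- `-log (a m)/m ≥ b' - log C / m`, and the right side tends to `b'`
    have hlim : Tendsto (fun m : ℕ => b' - Real.log C / (m : ℝ)) atTop (𝓝 (b' - 0)) :=
      tendsto_const_nhds.sub (tendsto_const_div_atTop_nhds_zero_nat (Real.log C))
    rw [sub_zero] at hlim
    have hev := (tendsto_order.1 hlim).1 b hbb'
    filter_upwards [hev, eventually_ge_atTop 1] with m hm hm1
    have hm0 : (0 : ℝ) < m := by exact_mod_cast hm1
    have hlog : Real.log (a m) ≤ Real.log C + m * -b' := by
      have h1 := Real.log_le_log (ha m) (hC m)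
      rw [Real.log_mul hC0.ne' (pow_ne_zero _ (Real.exp_pos _).ne'), Real.log_pow, Real.log_exp] at h1
      linarith
    calc b < b' - Real.log C / m := hm
      _ ≤ -Real.log (a m) / m := by
          rw [le_div_iff₀ hm0, sub_mul, div_mul_cancel₀ _ hm0.ne']
          linarith
  · -- upper estimate: eventually `-log (a m) / m < b` for every `b > -log s`
    intro b hb
    obtain ⟨c, hc, hca⟩ := hlow
    have hlim : Tendsto (fun m : ℕ => -Real.log s + -Real.log c / (m : ℝ)) atTop (𝓝 (-Real.log s + 0)) :=
      tendsto_const_nhds.add (tendsto_const_div_atTop_nhds_zero_nat (-Real.log c))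
    rw [add_zero] at hlim
    have hev := (tendsto_order.1 hlim).2 b hb
    filter_upwards [hev, eventually_ge_atTop 1] with m hm hm1
    have hm0 : (0 : ℝ) < m := by exact_mod_cast hm1
    have hlog : Real.log c + m * Real.log s ≤ Real.log (a m) := by
      have h1 := Real.log_le_log (mul_pos hc (pow_pos hs m)) (hca m)
      rwa [Real.log_mul hc.ne' (pow_ne_zero _ hs.ne'), Real.log_pow] at h1
    calc -Real.log (a m) / m ≤ -Real.log s + -Real.log c / m := by
          rw [div_le_iff₀ hm0, add_mul, div_mul_cancel₀ _ hm0.ne']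
          linarith
      _ < b := hm

/-- **S1 from the reshaped stubs** D1, D2 (marked half), S1'. -/
theorem oneClusterRateIsEscapeRate_of (hD1 : Registered.stub_oneClusterDictionary)
    (hD2 : Registered.stub_planarReachable) (hS1 : Registered.stub_oneClusterSpectral) :
    OneClusterRateIsEscapeRate :=
  hS1 hD1 hD2.1

/-- `p₂(m,n) > 0` for `n ≥ 1` (landed Negative lemma `pTwo_ge`: the ladder configuration). -/
theorem pTwo_pos {m n : ℕ} (hn : 1 ≤ n) :
    0 < (bondPercolation (zdGraph 2) half).real (twoClusterEvent m n) :=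
  lt_of_lt_of_le (by positivity)
    (Summit.CriticalPhenomena.CardyFormulaZ2.Theorems.StripClusterRates.Negative.pTwo_ge (m := m) hn)

/-- **S2 from the reshaped stubs** D3, S2a, S2b (and `pTwo_ge` for `s > 0`). -/
theorem twoClusterRateIsRelaxationRate_of (hD3 : Registered.stub_twoClusterDictionary)
    (hU : Registered.stub_relaxationUpper) (hL : Registered.stub_relaxationLower) :
    TwoClusterRateIsRelaxationRate := by
  intro n hn
  obtain ⟨s, hmod, hup⟩ := hU n hn
  obtain ⟨⟨μ, v, hev, hμ1, hμs⟩, hdom⟩ := hmod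
  obtain ⟨c, hc, hlow⟩ := hL n hn μ v hev hμ1
  obtain ⟨c', hc', hdict⟩ := hD3 n hn
  rw [hμs] at hlow
  -- two-sided geometric bounds for `p₂`
  have hlow' : ∀ m, c' * c * s ^ m ≤ (bondPercolation (zdGraph 2) half).real (twoClusterEvent m n) := by
    intro m
    calc c' * c * s ^ m = c' * (c * s ^ m) := by ring
      _ ≤ c' * dis n m := mul_le_mul_of_nonneg_left (hlow m) hc'.le
      _ ≤ _ := (hdict m).1
  have hup' : ∀ s' : ℝ, s < s' → ∃ C : ℝ, ∀ m,
      (bondPercolation (zdGraph 2) half).real (twoClusterEvent m n) ≤ C * s' ^ m := by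
    intro s' hs'
    obtain ⟨C, hC⟩ := hup s' hs'
    exact ⟨C, fun m => ((hdict m).2).trans (hC m)⟩
  -- `s > 0`: otherwise `p₂ ≤ C (1/16)^m` contradicts `p₂ ≥ (1/2)(1/8)^m`
  have hs0 : 0 ≤ s := by rw [← hμs]; exact norm_nonneg μ
  have hs : 0 < s := by
    by_contra hneg
    have hs00 : s = 0 := le_antisymm (not_lt.1 hneg) hs0
    obtain ⟨C, hC⟩ := hup' (1 / 16) (by rw [hs00]; norm_num)
    have hC0 : 0 < C := by
      have h0 := (pTwo_pos (m := 0) hn).trans_le (hC 0)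
      simpa using h0
    -- `(1/2)^(3m+1) ≤ C (1/16)^m`, i.e. `2^m ≤ 2C`, fails for large `m`
    have key : ∀ m : ℕ, (2 : ℝ) ^ m ≤ 2 * C := by
      intro m
      have h1 := (Summit.CriticalPhenomena.CardyFormulaZ2.Theorems.StripClusterRates.Negative.pTwo_ge
        (m := m) hn).trans (hC m)
      have h2 : (1 / 2 : ℝ) ^ (3 * m + 1) = (2 : ℝ) ^ m * ((1 / 2) * (1 / 16 : ℝ) ^ m) := by
        rw [pow_succ, pow_mul]
        have : ((1 / 2 : ℝ) ^ 3) = (2 : ℝ) * (1 / 16) := by norm_num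
        rw [this, mul_pow]
        ring
      rw [h2] at h1
      have hpos : (0 : ℝ) < (1 / 2) * (1 / 16 : ℝ) ^ m := by positivity
      have h3 : (2 : ℝ) ^ m * ((1 / 2) * (1 / 16 : ℝ) ^ m) ≤ (2 * C) * ((1 / 2) * (1 / 16 : ℝ) ^ m) := by
        calc _ ≤ C * (1 / 16 : ℝ) ^ m := h1
          _ = (2 * C) * ((1 / 2) * (1 / 16 : ℝ) ^ m) := by ring
      exact le_of_mul_le_mul_right h3 hpos
    obtain ⟨m, hm⟩ := pow_unbounded_of_one_lt (2 * C) (by norm_num : (1 : ℝ) < 2)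
    exact absurd (key m) (not_le.2 hm)
  refine ⟨-Real.log s, ?_, ?_⟩
  · -- the rate
    have h := tendsto_rate_of_geometric_bounds (a := fun m => (bondPercolation (zdGraph 2) half).real
      (twoClusterEvent m n)) hs (fun m => pTwo_pos hn) ⟨c' * c, mul_pos hc' hc, hlow'⟩ hup'
    exact h
  · -- the modulus clause at `e^{-(-log s)} = s`
    rw [neg_neg, Real.exp_log hs]
    exact ⟨⟨μ, v, hev, hμ1, hμs⟩, hdom⟩

/-- **Composition (reshape 4).** Hypotheses: the two registered open stubs `Registered.stub_rectCardyOne` (RC₁, γ₁: Cardy's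
value for the lattice rectangles `(Ak-2)×(k-2)`, `k → ∞` — a corollary of `CardyRectangle` / crux 4 / the conjunct, see
`rectCardyOne_of_cardyRectangle`, `rectCardyOne_of_cardyFormulaZ2`) and `Registered.stub_kacTwo` (K₂, γ₂: Kac asymptotics of the
relaxation rate; Bethe decomposition `relaxationRateKac_of_bethe`). The crux `CardyBoundaryCoulombGas.StripClusterRates` is
concluded BY NAME: the rates `γ₁, γ₂` are CHOSEN from the LANDED S1/S2 (`oneClusterRateIsEscapeRate_of`,
`twoClusterRateIsRelaxationRate_of`; junk `0` at width `0`); `n·γ₁(n) → π/3` is lead -1's LANDED composition `stub_composeOne` fed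
with the LANDED `stub_sandwichUpper`, `stub_lamRLog`, `stub_cardyLog` and the stub `hRC`; `n·γ₂(n) → 2π` is `hK₂` applied to
`e^{-γ₂(n)}`. -/
theorem rates_of_rc_kacTwo (hRC : Registered.stub_rectCardyOne) (hK₂ : RelaxationRateKac) :
    ∃ γ₁ γ₂ : ℕ → ℝ, Tendsto (fun n : ℕ ↦ (n : ℝ) * γ₁ n) atTop (𝓝 (Real.pi / 3)) ∧ Tendsto (fun n : ℕ ↦ (n : ℝ) * γ₂ n) atTop (𝓝 (2 * Real.pi)) ∧ (∀ n : ℕ, 1 ≤ n → Tendsto (fun m : ℕ ↦ -Real.log (crossingProb half m n) / (m : ℝ)) atTop (𝓝 (γ₁ n))) ∧ (∀ n : ℕ, 1 ≤ n → Tendsto (fun m : ℕ ↦ -Real.log ((bondPercolation (zdGraph 2) half).real {ω | ∃ x₁ ∈ (leftSide m n : Set (Site 2)), ∃ y₁ ∈ (rightSide m n : Set (Site 2)), ∃ x₂ ∈ (leftSide m n : Set (Site 2)), ∃ y₂ ∈ (rightSide m n : Set (Site 2)), ω ∈ openConnIn (rectangle m n : Set (Site 2)) x₁ y₁ ∧ ω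 ∈ openConnIn (rectangle m n : Set (Site 2)) x₂ y₂ ∧ ω ∉ openConnIn (rectangle m n : Set (Site 2)) x₁ x₂}) / (m : ℝ)) atTop (𝓝 (γ₂ n))) := by
  -- S1 / S2 from the LANDED stubs
  have h₁ : OneClusterRateIsEscapeRate :=
    oneClusterRateIsEscapeRate_of oneClusterDictionary_holds planarReachable_holds oneClusterSpectral_holds
  have h₂ : TwoClusterRateIsRelaxationRate :=
    twoClusterRateIsRelaxationRate_of twoClusterDictionary_holds relaxationUpper_holds relaxationLower_holds
  have h₄ : RelaxationRateKac := hK₂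
  -- the rates, chosen from S1 / S2 at widths `n ≥ 1` (junk value `0` at width `0`)
  let γ₁ : ℕ → ℝ := fun n => if hn : 1 ≤ n then (h₁ n hn).choose else 0
  let γ₂ : ℕ → ℝ := fun n => if hn : 1 ≤ n then (h₂ n hn).choose else 0
  have hγ₁ : ∀ n : ℕ, ∀ hn : 1 ≤ n, γ₁ n = (h₁ n hn).choose := fun n hn => dif_pos hn
  have hγ₂ : ∀ n : ℕ, ∀ hn : 1 ≤ n, γ₂ n = (h₂ n hn).choose := fun n hn => dif_pos hn
  have hrate₁ : ∀ n : ℕ, 1 ≤ n → OneClusterRate n (γ₁ n) := by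
    intro n hn
    rw [hγ₁ n hn]
    exact (h₁ n hn).choose_spec.1
  refine ⟨γ₁, γ₂, ?_, ?_, hrate₁, ?_⟩
  · -- γ₁: lead -1's landed chain + the stub `hRC`
    exact stub_composeOne stub_sandwichUpper stub_lamRLog stub_cardyLog hRC γ₁ hrate₁
  · have hs : ∀ n : ℕ, 1 ≤ n → IsRelaxationModulus n (Real.exp (-γ₂ n)) := by
      intro n hn
      rw [hγ₂ n hn]
      exact (h₂ n hn).choose_spec.2
    have h := h₄ (fun n => Real.exp (-γ₂ n)) hs
    refine h.congr' (Eventually.of_forall fun n => ?_)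
    exact mul_neg_log_exp_neg n (γ₂ n)
  · intro n hn
    rw [hγ₂ n hn]
    exact (h₂ n hn).choose_spec.1

/-- **Conversely the crux implies K₂** (landed: `kacTwo_of_stripClusterRates`, p126523) — K₂ is NECESSARY. -/
example (h : Summit.CriticalPhenomena.CardyFormulaZ2.Theses.CardyBoundaryCoulombGas.StripClusterRates) :
    RelaxationRateKac :=
  fun s hs => kacTwo_of_stripClusterRates h s hs

/-- The Bethe-only closure of c1/c2 remains available as the LANDED reduction `stripClusterRates_of_bethePillars`
(p103356): the crux from BP₁, BI₂, BA₁, BA₂ (named statements of this file; no stub of this skeleton). -/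
example (hP₁ : BethePositiveVectorOne) (hI₂ : RelaxIsBethe) (hA₁ : BetheKacOne) (hA₂ : BetheKacTwo) :
    Summit.CriticalPhenomena.CardyFormulaZ2.Theses.CardyBoundaryCoulombGas.StripClusterRates :=
  stripClusterRates_of_kacGapAsymptotics
    (kacGapAsymptotics_of_bethe betheGroundExists_holds (escapeIsBethe_of_positiveVector hP₁) hI₂ hA₁ hA₂)

/-! ## Progress note by the continuation lead c5 (prover-line-stmt-CriticalPhenomena-13878-c5-0, 2026-08-16):
what RSW technology says about the γ₂-half — the two-sided window and the free half of the order transfer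

No reshape: the skeleton keeps its two registered stubs RC₁ `stub_rectCardyOne` (⟸ stmt-4782 ⟸ stmt-5660 ⟸ the conjunct,
all landed) and K₂ `stub_kacTwo` (open). This tenure landed, as `--supports`, the rigorous γ₂-knowledge that does NOT
need the value (7 files: `…BandEvent` p127194, `…BandIndependence` p127237, `…BandRateSum` p127235, `…BandLimitWindow`
p127223, `…BandLimitKac` p127191, `…TwoClusterUpperWindow` p127323, `…TwoClusterCardyOrderLiminf` p127342):
* BAND CONSTRUCTION (c3's `disprover-wanted`): `band_pTwo_ge : p₁(m,a)·p₁(m,b)·p₁(m+1,c) ≤ p₂(m,a+b+c+3)` (two open LR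
  crossings of the outer bands + no open TB crossing of the middle band — row clipping `exists_openConnIn_clip`, independence
  of row-disjoint bands, duality for the middle factor), hence the STRUCTURAL INEQUALITY between the crux's two rate functions
  `band_rateTwo_le : γ₂(a+b+c+3) ≤ γ₁(a) + γ₁(b) + γ₁(c)` and `band_rateTwo_le_three_mul : γ₂(3h+3) ≤ 3γ₁(h)`;
* THE UNCONDITIONAL WINDOW `nMul_rateTwo_limit_mem_window : 2 log 2 ≤ L₂ ≤ 144 log 2` for every pair of rate functions and
  every limit `L₂` of `n·γ₂(n)` (Aizenman 1997 Thm 3 for two spanning clusters, transfer-matrix order; previously only the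
  lower edge was in the tree);
* THE CONDITIONAL WINDOW `twoCluster_window_of_cardyFormulaZ2 : CardyFormulaZ2 → … → 2π/3 ≤ L₂ ≤ 3π` — the conjunct the route
  serves localises the two-cluster constant to `[2.09…, 9.42…]`, and no argument in the tree narrows it further;
* THE FREE HALF OF THE ORDER TRANSFER `nMul_rateTwo_limit_ge_of_cardyOrderKac` / `cardyOrder_liminf_transfer`: Cardy-order
  convergence `−log p₂(A·n,n) → g(A)` with `g(A)/A → c` forces `c ≤ L₂` (via `rateTwo_ge_finite`, from the landed
  `pTwo_submul`); the other half `L₂ ≤ c` needs SUPER-multiplicativity of `p₂` in the length with a width-uniform constant —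
  the one RSW-level statement (two-cluster quasi-multiplicativity in the strip) under which K₂ becomes EQUIVALENT to the
  Cardy-order three-arm strip exponent `h_{1,5} = 2` of the SLE₆ prediction chain. Census otherwise unchanged (c4's block). -/

/-- **c5 · the conjunct's window for the two-cluster constant** (landed `twoCluster_window_of_cardyFormulaZ2`, p127323): under
`CardyFormulaZ2`, every pair of rate functions of the crux and every limit `L₂` of `n·γ₂(n)` obey `2π/3 ≤ L₂ ≤ 3π`. -/
example (h : _root_.CardyFormulaZ2) (γ₁ γ₂ : ℕ → ℝ) (h₁ : ∀ n : ℕ, 1 ≤ n → OneClusterRate n (γ₁ n))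
    (h₂ : ∀ n : ℕ, 1 ≤ n → TwoClusterRate n (γ₂ n)) (L₂ : ℝ)
    (hL : Tendsto (fun n : ℕ ↦ (n : ℝ) * γ₂ n) atTop (𝓝 L₂)) : 2 * Real.pi / 3 ≤ L₂ ∧ L₂ ≤ 3 * Real.pi :=
  twoCluster_window_of_cardyFormulaZ2 h γ₁ γ₂ h₁ h₂ L₂ hL

/-- **c5 · the unconditional window** (landed `nMul_rateTwo_limit_mem_window`, p127323): `2 log 2 ≤ L₂ ≤ 144 log 2`. -/
example (γ₁ γ₂ : ℕ → ℝ) (h₁ : ∀ n : ℕ, 1 ≤ n → OneClusterRate n (γ₁ n))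
    (h₂ : ∀ n : ℕ, 1 ≤ n → TwoClusterRate n (γ₂ n)) (L₂ : ℝ)
    (hL : Tendsto (fun n : ℕ ↦ (n : ℝ) * γ₂ n) atTop (𝓝 L₂)) : 2 * Real.log 2 ≤ L₂ ∧ L₂ ≤ 144 * Real.log 2 :=
  nMul_rateTwo_limit_mem_window h₁ h₂ hL

/-- **c5 · the structural band inequality on the crux's own rates** (landed `stripClusterRates_band_inequality`, p127323). -/
example (h : Summit.CriticalPhenomena.CardyFormulaZ2.Theses.CardyBoundaryCoulombGas.StripClusterRates) :
    ∃ γ₁ γ₂ : ℕ → ℝ,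
      (∀ a b c : ℕ, 1 ≤ a → 1 ≤ b → 1 ≤ c → γ₂ (a + b + c + 3) ≤ γ₁ a + γ₁ b + γ₁ c) ∧
      Tendsto (fun n : ℕ ↦ (n : ℝ) * γ₁ n) atTop (𝓝 (Real.pi / 3)) ∧
      Tendsto (fun n : ℕ ↦ (n : ℝ) * γ₂ n) atTop (𝓝 (2 * Real.pi)) :=
  stripClusterRates_band_inequality h

/-- **c5 · the free half of the order transfer** (landed `nMul_rateTwo_limit_ge_of_cardyOrderKac`, p127342): Cardy-order
two-cluster Kac (`g(A)/A → 2π`) already forces `2π ≤ L₂`; with the conjunct's window, `2π ≤ L₂ ≤ 3π`. -/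
example (h : _root_.CardyFormulaZ2) (γ₁ γ₂ : ℕ → ℝ) (h₁ : ∀ n : ℕ, 1 ≤ n → OneClusterRate n (γ₁ n))
    (h₂ : ∀ n : ℕ, 1 ≤ n → TwoClusterRate n (γ₂ n)) (g : ℕ → ℝ)
    (hg : ∀ A : ℕ, 1 ≤ A → Tendsto (fun n : ℕ ↦ -Real.log
      ((bondPercolation (zdGraph 2) half).real (twoClusterEvent (A * n) n))) atTop (𝓝 (g A)))
    (hKac : Tendsto (fun A : ℕ ↦ g A / A) atTop (𝓝 (2 * Real.pi))) (L₂ : ℝ)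
    (hL : Tendsto (fun n : ℕ ↦ (n : ℝ) * γ₂ n) atTop (𝓝 L₂)) : 2 * Real.pi ≤ L₂ ∧ L₂ ≤ 3 * Real.pi :=
  ⟨nMul_rateTwo_limit_ge_of_cardyOrderKac h₂ hg hKac hL,
    (twoCluster_window_of_cardyFormulaZ2 h γ₁ γ₂ h₁ h₂ L₂ hL).2⟩

/-! ### c5, wave 2 and the order transfer modulo QM₂ (all LANDED)
* BK–REIMER THREE-ARM BOUND `arm_pTwo_le : p₂(m,n) ≤ p₁(m,n)²·p₁(m+1,n−1)` (`…ArmEvent` p127644: the two-cluster event lies in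
  `LR □ (LR □ TBᶜ)`; `…ArmReimer` p127682: Reimer twice + duality), hence `arm_rateTwo_ge : 2γ₁(n)+γ₁(n−1) ≤ γ₂(n)`,
  `arm_rateTwo_ge_three_mul : 3γ₁(n) ≤ γ₂(n)` (n ≥ 2) and the SHARPENED WINDOWS `3 log 2 ≤ L₂ ≤ 144 log 2` (unconditional),
  `π ≤ L₂ ≤ 3π` under the conjunct (`…TwoClusterLowerWindow`): in Kac units the two-cluster exponent is confined to `[1, 3]` by
  the independent-arm bounds (Reimer below, bands above); the crux claims `h_{1,5} = 2`.
* ORDER TRANSFER MODULO QM₂ (`…TwoClusterQuasiMultTransfer`): under two-cluster quasi-multiplicativity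
  `QM₂ : ∃ C > 0, ∃ k, ∀ n ≥ 1, ∀ m₁ m₂, p₂(m₁,n)·p₂(m₂,n) ≤ C·p₂(m₁+m₂+k·n, n)` (hypothesis; blueprint
  `Lines/two-cluster-rate-is-stationary-gap-QM-blueprint.md`) and Cardy-order convergence `−log p₂(A·n,n) → g(A)`,
  `g(A)/A → c`, the full sequence converges: `n·γ₂(n) → c` (`tendsto_nMul_rateTwo_of_quasiMult`); with `c = 2π` this is the
  γ₂-conjunct (`kacTwoHalf_of_quasiMult_of_cardyOrderKac`). So K₂ ⟸ QM₂ ∧ (Cardy-order `h_{1,5} = 2`), and QM₂ is the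
  provable γ₂-side item to file. -/

/-- **c5 · the sharpened conjunct window** (landed `twoCluster_window_of_cardyFormulaZ2'`): `π ≤ L₂ ≤ 3π`. -/
example (h : _root_.CardyFormulaZ2) (γ₁ γ₂ : ℕ → ℝ) (h₁ : ∀ n : ℕ, 1 ≤ n → OneClusterRate n (γ₁ n))
    (h₂ : ∀ n : ℕ, 1 ≤ n → TwoClusterRate n (γ₂ n)) (L₂ : ℝ)
    (hL : Tendsto (fun n : ℕ ↦ (n : ℝ) * γ₂ n) atTop (𝓝 L₂)) : Real.pi ≤ L₂ ∧ L₂ ≤ 3 * Real.pi :=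
  twoCluster_window_of_cardyFormulaZ2' h γ₁ γ₂ h₁ h₂ L₂ hL

/-- **c5 · three-arm / band sandwich on the crux's own rates** (landed `stripClusterRates_three_arm_sandwich`). -/
example (h : Summit.CriticalPhenomena.CardyFormulaZ2.Theses.CardyBoundaryCoulombGas.StripClusterRates) :
    ∃ γ₁ γ₂ : ℕ → ℝ,
      (∀ n : ℕ, 2 ≤ n → 3 * γ₁ n ≤ γ₂ n) ∧ (∀ h : ℕ, 1 ≤ h → γ₂ (3 * h + 3) ≤ 3 * γ₁ h) ∧
      Tendsto (fun n : ℕ ↦ (n : ℝ) * γ₁ n) atTop (𝓝 (Real.pi / 3)) ∧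
      Tendsto (fun n : ℕ ↦ (n : ℝ) * γ₂ n) atTop (𝓝 (2 * Real.pi)) :=
  stripClusterRates_three_arm_sandwich h

/-- **c5 · the crux from the conjunct, QM₂ and Cardy-order two-cluster Kac** (landed `tendsto_nMul_rateTwo_of_quasiMult` +
`stripClusterRates_of_cardyFormulaZ2_of_kacTwo` + `twoClusterKac_iff_kacTwo`): the γ₂-half no longer needs a value
mechanism in TM order once QM₂ is proved — it is then the Cardy-order `h_{1,5} = 2`. -/
example (h : _root_.CardyFormulaZ2)
    (hQM : ∃ C : ℝ, 0 < C ∧ ∃ k : ℕ, ∀ n : ℕ, 1 ≤ n → ∀ m₁ m₂ : ℕ,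
      (bondPercolation (zdGraph 2) half).real (twoClusterEvent m₁ n) *
        (bondPercolation (zdGraph 2) half).real (twoClusterEvent m₂ n) ≤
          C * (bondPercolation (zdGraph 2) half).real (twoClusterEvent (m₁ + m₂ + k * n) n))
    (g : ℕ → ℝ)
    (hg : ∀ A : ℕ, 1 ≤ A → Tendsto (fun n : ℕ ↦ -Real.log
      ((bondPercolation (zdGraph 2) half).real (twoClusterEvent (A * n) n))) atTop (𝓝 (g A)))
    (hKac : Tendsto (fun A : ℕ ↦ g A / A) atTop (𝓝 (2 * Real.pi))) :
    Summit.CriticalPhenomena.CardyFormulaZ2.Theses.CardyBoundaryCoulombGas.StripClusterRates :=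
  stripClusterRates_of_cardyFormulaZ2_of_kacTwo h
    (twoClusterKac_iff_kacTwo.1 fun _γ hγ => tendsto_nMul_rateTwo_of_quasiMult hγ hQM hg hKac)

/-! ## Reshape 5 by the continuation lead c6 (prover-line-stmt-CriticalPhenomena-13878-c6-0, 2026-08-16):
the γ₂-half by ORDER TRANSFER through END-CONFINED GLUING — K₂ demoted, the open input becomes CARDY-ORDER

c5 isolated the order transfer "Cardy order ⇒ transfer-matrix order" as the provable γ₂-side content and proved its
liminf half; its limsup half was left conditional on QUASI-MULTIPLICATIVITY of `p₂` in the length with a width-uniform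
constant (QM₂ = arm separation in the strip, Kesten 1987; weeks of work). Reshape 5 removes QM₂: instead of gluing
GENERIC two-cluster blocks (which needs separation of the three alternating arms at the block ends), glue PRE-SEPARATED
blocks. Unit `b`, width `N = 3b+2` (rows `0..3b+2`), block `[0,M]×[0,N]`, end zones `z₀ ≤ b` and `z₀ ≥ M−b`:
* `cgPlus M b` (INCREASING): an open path from the left side to the right side inside the bottom dumbbell `cgBot`
  (= the block, except that inside the end zones only rows `0..b` are allowed) + an open bottom-to-top crossing of the
  left-end bottom square `[0,b]²` (the FENCE that ties this cluster to the bottom side) + the mirror images in the top rows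
  `2b+2..3b+2`;
* `cgMinus M b` (DECREASING): a dual-open (= crossing closed edges only) path of faces from the dual column `−1` to the dual
  column `M` inside `cgMid` (faces `[−1,M]×[0,3b+1]`, lower-left-corner indexing, except that inside the end zones only the
  face rows `b+1..2b` are allowed);
* `stub_cgTwoCluster`: `cgPlus ∩ cgMinus ⊆ E₂` (two LR crossings of `[0,M]×[0,3b+2]` not joined inside): a joining path
  would join the bottom side to the top side (fences + "LR meets TB in a box", `exists_mem_support_of_crossing`), i.e. an open
  TOP–BOTTOM crossing of the rectangle, which the dual LEFT–RIGHT crossing forbids (`lrCrossing_xor_dualTBCrossing_holds`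
  transposed by double duality, `map_sub_one_mem_dualConfig_dualConfig`);
* `stub_cgGluePlus` / `stub_cgGlueMinus` (deterministic gluing): block 1 `[0,M₁]`, block 2 translated by `(M₁+b+2, 0)`,
  junction columns `M₁+1..M₁+b+1`; an open LR crossing of the bottom glue box `[M₁−b, M₁+2b+2]×[0,b]` plus open TB
  crossings of its two end squares tie the bottom paths of the two blocks together (tails/heads of confined paths cross
  the end squares the long way), similarly on top, and dually in the middle face box `[M₁−b, M₁+2b+2]×[b+1,2b]`; the
  glued configuration is again `cgPlus`/`cgMinus` of the long block `M₁+b+2+M₂` (confinement at the outer ends and the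
  left fences are inherited);
* `stub_cgGlueIndep` / `stub_cgGlueLocal` (probability): `P(F₁ ∩ F₂') = f(M₁) f(M₂)` and `c · P(F₁ ∩ F₂') ≤ P(F₁ ∩ F₂' ∩ G⁺ ∩ G⁻)`
  with an ABSOLUTE `c > 0` (`b ≥ 3`): independence of the two blocks (disjoint edge sets, gap of `b+1 ≥ 2` columns), translation invariance, NOLIN'S
  GENERALISED FKG `bondPercolation_locallyMonotone_fkg` with `P` = edges of the two outer glue boxes (where the block
  events are increasing: only `cgPlus` looks there), `M` = edges crossed by the middle face box (only `cgMinus` looks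
  there), Harris for the three increasing glue crossings, `bondPercolation_map_dualConfig_holds` for the three dual ones,
  and RSW (`rsw_lowerBound_holds` k = 4, `crossingProb_half_succ_self_holds`) for boxes of aspect ≤ 4;
* `cg_rate_le_of_supermul` (real analysis, proved): super-multiplicativity up to `c` with gap `J` of a minorant `f ≤ p` bounds the rate of
  `p` from ABOVE: `γ ≤ (−log f(M) − log c)/(M+J)` (Fekete along `k(M+J) − J`);
* `stub_cardyOrderTwo` (OPEN — the Cardy-order two-cluster Kac statement `h_{1,5} = 2`, SLE₆ prediction chain, in the
  form the transfer consumes): `p₂(A·n, n) ≤ e^{−g(A)}` eventually in `n` with `g(A)/A → 2π` (upper, plain event) and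
  `f(A·(3b+2), b) ≥ e^{−G(A)}` eventually in `b` with `G(A)/A → 2π` (lower, confined event; confinement costs `O(1)` in
  Cardy order).
Composition (all glue kernel-checked below): `γ₂(3b+2) ≤ (G(A) − log c)/(A(3b+2))`, `γ₂` antitone in the width
(`rateTwo_antitone`, landed) interpolates the widths `≢ 2 (mod 3)`, the liminf half is c5's; hence `n·γ₂(n) → 2π` for
every family of two-cluster rates (`tendsto_nMul_rateTwo_of_cardyOrderTwo`), K₂ follows (`kacTwo_of_cardyOrderTwo`), and
`StripClusterRates_of : stub_rectCardyOne → stub_cardyOrderTwo → StripClusterRates`. Registered stubs after reshape 5: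
`stub_rectCardyOne` (open, = stmt-4782's business), `stub_cardyOrderTwo` (open, Cardy order), and the five provable
`stub_cgTwoCluster`, `stub_cgGluePlus`, `stub_cgGlueMinus`, `stub_cgGlueIndep`, `stub_cgGlueLocal` (the analysis lemma CG4 `cg_rate_le_of_supermul` is proved here). -/

section ConfinedGluing

open MeasureTheory
open Summit.CriticalPhenomena.CardyFormulaZ2.Theorems.StripClusterRates.Negative (pTwo rateSeqTwo)

/-- The bottom dumbbell of the block `[0,M]×[0,3b+2]`: inside the end zones only the rows `0..b`. -/
def cgBot (M b : ℕ) : Set (Site 2) :=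
  {z ∈ (rectangle M (3 * b + 2) : Set (Site 2)) | (z 0 ≤ (b : ℤ) ∨ (M : ℤ) ≤ z 0 + b) → z 1 ≤ (b : ℤ)}

/-- The top dumbbell: inside the end zones only the rows `2b+2..3b+2`. -/
def cgTop (M b : ℕ) : Set (Site 2) :=
  {z ∈ (rectangle M (3 * b + 2) : Set (Site 2)) | (z 0 ≤ (b : ℤ) ∨ (M : ℤ) ≤ z 0 + b) → 2 * (b : ℤ) + 2 ≤ z 1}

/-- The middle dual dumbbell: faces `(-1,0) + [0,M+1]×[0,3b+1]` (lower-left corners), inside the end zones only the face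
rows `b+1..2b`. -/
def cgMid (M b : ℕ) : Set (Site 2) :=
  {z ∈ ((· + pt (-1) 0) '' (rectangle (M + 1) (3 * b + 1) : Set (Site 2))) | (z 0 ≤ (b : ℤ) ∨ (M : ℤ) ≤ z 0 + b) → (b : ℤ) + 1 ≤ z 1 ∧ z 1 ≤ 2 * (b : ℤ)}

/-- The increasing confined event `F⁺(M,b)`: confined open LR crossings of the two outer dumbbells + the two left fences
(open TB crossings of `[0,b]²` and of `(0,2b+2)+[0,b]²`). -/
def cgPlus (M b : ℕ) : Set (BondConfig (Site 2)) :=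
  (openCrossing {z ∈ (rectangle M (3 * b + 2) : Set (Site 2)) | (z 0 ≤ (b : ℤ) ∨ (M : ℤ) ≤ z 0 + b) → z 1 ≤ (b : ℤ)} (leftSide M (3 * b + 2) : Set (Site 2)) (rightSide M (3 * b + 2) : Set (Site 2)) ∩ tbCrossing b b ∩ openCrossing {z ∈ (rectangle M (3 * b + 2) : Set (Site 2)) | (z 0 ≤ (b : ℤ) ∨ (M : ℤ) ≤ z 0 + b) → 2 * (b : ℤ) + 2 ≤ z 1} (leftSide M (3 * b + 2) : Set (Site 2)) (rightSide M (3 * b + 2) : Set (Site 2)) ∩ (BondConfig.relabel (sym2Equiv (Site.shift (-pt 0 (2 * (b : ℤ) + 2))))) ⁻¹' tbCrossing b b)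

/-- The decreasing confined event `F⁻(M,b)`: a dual-open LR crossing of the middle dual dumbbell. -/
def cgMinus (M b : ℕ) : Set (BondConfig (Site 2)) :=
  (dualConfig ⁻¹' openCrossing {z ∈ ((· + pt (-1) 0) '' (rectangle (M + 1) (3 * b + 1) : Set (Site 2))) | (z 0 ≤ (b : ℤ) ∨ (M : ℤ) ≤ z 0 + b) → (b : ℤ) + 1 ≤ z 1 ∧ z 1 ≤ 2 * (b : ℤ)} ((· + pt (-1) 0) '' (leftSide (M + 1) (3 * b + 1) : Set (Site 2))) ((· + pt (-1) 0) '' (rightSide (M + 1) (3 * b + 1) : Set (Site 2))))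

/-- The increasing glue event at the interface of block 1 `[0,M₁]` and block 2 `(M₁+b+2,0) + [0,M₂]`: open LR crossings
of the two outer glue boxes `(M₁-b, 0 | 2b+2) + [0,3b+2]×[0,b]` and open TB crossings of their end squares. -/
def cgGluePlus (M₁ b : ℕ) : Set (BondConfig (Site 2)) :=
  (lrCrossingAt (pt ((M₁ : ℤ) - b) 0) (3 * b + 2) b ∩ (BondConfig.relabel (sym2Equiv (Site.shift (-pt ((M₁ : ℤ) - b) 0)))) ⁻¹' tbCrossing b b ∩ (BondConfig.relabel (sym2Equiv (Site.shift (-pt ((M₁ : ℤ) + b + 2) 0)))) ⁻¹' tbCrossing b b ∩ lrCrossingAt (pt ((M₁ : ℤ) - b) (2 * (b : ℤ) + 2)) (3 * b + 2) b ∩ (BondConfig.relabel (sym2Equiv (Site.shift (-pt ((M₁ : ℤ) - b) (2 * (b : ℤ) + 2))))) ⁻¹' tbCrossing b b ∩ (BondConfig.relabel (sym2Equiv (Site.shift (-pt ((M₁ : ℤ) + b + 2) (2 * (b : ℤ) + 2))))) ⁻¹' tbCrossing b b)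

/-- The decreasing glue event: dual-open LR crossing of the middle glue face box `(M₁-b, b+1) + [0,3b+2]×[0,b-1]` and
dual-open TB crossings of its two end boxes. -/
def cgGlueMinus (M₁ b : ℕ) : Set (BondConfig (Site 2)) :=
  (dualConfig ⁻¹' (lrCrossingAt (pt ((M₁ : ℤ) - b) ((b : ℤ) + 1)) (3 * b + 2) (b - 1) ∩ (BondConfig.relabel (sym2Equiv (Site.shift (-pt ((M₁ : ℤ) - b) ((b : ℤ) + 1))))) ⁻¹' tbCrossing b (b - 1) ∩ (BondConfig.relabel (sym2Equiv (Site.shift (-pt ((M₁ : ℤ) + b + 1) ((b : ℤ) + 1))))) ⁻¹' tbCrossing (b + 1) (b - 1)))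

/-- The confined block event `F = F⁺ ∩ F⁻`. -/
def cgF (M b : ℕ) : Set (BondConfig (Site 2)) := cgPlus M b ∩ cgMinus M b

/-- `f(M,b) = P_{1/2}(F(M,b))`. -/
def cgf (M b : ℕ) : ℝ := (bondPercolation (zdGraph 2) half).real (cgF M b)

/-! ### Registered stubs of reshape 5 (`sorry` lives only here; statements fully expanded) -/

-- stub_cgTwoCluster: LANDED p130885 (imported from Theorems/CardyBoundaryCoulombGasStripClusterRatesCgTwoCluster.lean).

-- stub_cgGluePlus: LANDED p130767 (imported from Theorems/CardyBoundaryCoulombGasStripClusterRatesCgGluePlus.lean).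

-- stub_cgGlueMinus: LANDED p130854 (imported from Theorems/CardyBoundaryCoulombGasStripClusterRatesCgGlueMinus.lean).

-- stub_cgGlueIndep: LANDED p130727 (imported from Theorems/CardyBoundaryCoulombGasStripClusterRatesCgGlueIndep.lean).

-- stub_cgGlueLocal: LANDED p131241 (imported from Theorems/CardyBoundaryCoulombGasStripClusterRatesCgGlueLocal.lean;
-- helpers cg_glueBoxes_prob p130714, nl_* tools p130995, cg_glue_nolin p131122).


/-- **CO₂ · Cardy-order two-cluster Kac, `h_{1,5} = 2`** (OPEN; Cardy 1998 eq. (bb) `n = 2` in CARDY order = the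
half-plane three-arm exponent of the SLE₆ prediction chain, in the two-sided form the order transfer consumes: the plain
event from above, the end-confined event from below). Registered stub `stub_cardyOrderTwo`.
[Cardy1998 eq. (bb); SmirnovWerner2001 (triangular-lattice analogue); LawlerSchrammWerner2001 half-plane exponents] -/
theorem stub_cardyOrderTwo :
    (∃ g : ℕ → ℝ, Tendsto (fun A : ℕ ↦ g A / A) atTop (𝓝 (2 * Real.pi)) ∧ ∀ A : ℕ, 1 ≤ A → ∀ᶠ n : ℕ in atTop, (bondPercolation (zdGraph 2) half).real {ω | ∃ x₁ ∈ (leftSide (A * n) n : Set (Site 2)), ∃ y₁ ∈ (rightSide (A * n) n : Set (Site 2)), ∃ x₂ ∈ (leftSide (A * n) n : Set (Site 2)), ∃ y₂ ∈ (rightSide (A * n) n : Set (Site 2)), ω ∈ openConnIn (rectangle (A * n) n : Set (Site 2)) x₁ y₁ ∧ ω ∈ openConnIn (rectangle (A * n) n : Set (Site 2)) x₂ y₂ ∧ ω ∉ openConnIn (rectangle (A * n) n : Set (Site 2)) x₁ x₂} ≤ Real.exp (-g A)) ∧ (∃ G : ℕ → ℝ, Tendsto (fun A : ℕ ↦ G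 A / A) atTop (𝓝 (2 * Real.pi)) ∧ ∀ A : ℕ, 1 ≤ A → ∀ᶠ b : ℕ in atTop, Real.exp (-G A) ≤ (bondPercolation (zdGraph 2) half).real ((openCrossing {z ∈ (rectangle (A * (3 * b + 2) : ℕ) (3 * b + 2) : Set (Site 2)) | (z 0 ≤ (b : ℤ) ∨ ((A * (3 * b + 2) : ℕ) : ℤ) ≤ z 0 + b) → z 1 ≤ (b : ℤ)} (leftSide (A * (3 * b + 2) : ℕ) (3 * b + 2) : Set (Site 2)) (rightSide (A * (3 * b + 2) : ℕ) (3 * b + 2) : Set (Site 2)) ∩ tbCrossing b b ∩ openCrossing {z ∈ (rectangle (A * (3 * b + 2) : ℕ) (3 * b + 2) : Set (Site 2)) | (z 0 ≤ (b : ℤ) ∨ ((A * (3 * b + 2) : ℕ) : ℤ) ≤ z 0 + b) → 2 * (b : ℤ) + 2 ≤ z 1} (leftSide (A * (3 * b + 2) : ℕ) (3 * b + 2) : Set (Site 2)) (rightSide (A * (3 * b + 2) : ℕ) (3 * b + 2) : Set (Site 2)) ∩ (BondConfig.relabel (sym2Equiv (Site.shift (-pt 0 (2 * (b : ℤ) +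 2))))) ⁻¹' tbCrossing b b) ∩ (dualConfig ⁻¹' openCrossing {z ∈ ((· + pt (-1) 0) '' (rectangle ((A * (3 * b + 2) : ℕ) + 1) (3 * b + 1) : Set (Site 2))) | (z 0 ≤ (b : ℤ) ∨ ((A * (3 * b + 2) : ℕ) : ℤ) ≤ z 0 + b) → (b : ℤ) + 1 ≤ z 1 ∧ z 1 ≤ 2 * (b : ℤ)} ((· + pt (-1) 0) '' (leftSide ((A * (3 * b + 2) : ℕ) + 1) (3 * b + 1) : Set (Site 2))) ((· + pt (-1) 0) '' (rightSide ((A * (3 * b + 2) : ℕ) + 1) (3 * b + 1) : Set (Site 2)))))) := by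
  sorry

/-! ### Name-keyed aliases of the reshape-5 statements -/

/-- CO₂ as a named statement. -/
def CardyOrderTwo : Prop :=
  (∃ g : ℕ → ℝ, Tendsto (fun A : ℕ ↦ g A / A) atTop (𝓝 (2 * Real.pi)) ∧ ∀ A : ℕ, 1 ≤ A → ∀ᶠ n : ℕ in atTop, (bondPercolation (zdGraph 2) half).real {ω | ∃ x₁ ∈ (leftSide (A * n) n : Set (Site 2)), ∃ y₁ ∈ (rightSide (A * n) n : Set (Site 2)), ∃ x₂ ∈ (leftSide (A * n) n : Set (Site 2)), ∃ y₂ ∈ (rightSide (A * n) n : Set (Site 2)), ω ∈ openConnIn (rectangle (A * n) n : Set (Site 2)) x₁ y₁ ∧ ω ∈ openConnIn (rectangle (A * n) n : Set (Site 2)) x₂ y₂ ∧ ω ∉ openConnIn (rectangle (A * n) n : Set (Site 2)) x₁ x₂} ≤ Real.exp (-g A)) ∧ (∃ G : ℕ → ℝ, Tendsto (fun A : ℕ ↦ G A / A) atTop (𝓝 (2 * Real.pi)) ∧ ∀ A : ℕ, 1 ≤ A → ∀ᶠ b : ℕ in atTop, Real.exp (-G A) ≤ (bondPercolation (zdGraph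 2) half).real ((openCrossing {z ∈ (rectangle (A * (3 * b + 2) : ℕ) (3 * b + 2) : Set (Site 2)) | (z 0 ≤ (b : ℤ) ∨ ((A * (3 * b + 2) : ℕ) : ℤ) ≤ z 0 + b) → z 1 ≤ (b : ℤ)} (leftSide (A * (3 * b + 2) : ℕ) (3 * b + 2) : Set (Site 2)) (rightSide (A * (3 * b + 2) : ℕ) (3 * b + 2) : Set (Site 2)) ∩ tbCrossing b b ∩ openCrossing {z ∈ (rectangle (A * (3 * b + 2) : ℕ) (3 * b + 2) : Set (Site 2)) | (z 0 ≤ (b : ℤ) ∨ ((A * (3 * b + 2) : ℕ) : ℤ) ≤ z 0 + b) → 2 * (b : ℤ) + 2 ≤ z 1} (leftSide (A * (3 * b + 2) : ℕ) (3 * b + 2) : Set (Site 2)) (rightSide (A * (3 * b + 2) : ℕ) (3 * b + 2) : Set (Site 2)) ∩ (BondConfig.relabel (sym2Equiv (Site.shift (-pt 0 (2 * (b : ℤ) + 2))))) ⁻¹' tbCrossing b b) ∩ (dualConfig ⁻¹' openCrossing {z ∈ ((· + pt (-1) 0) '' (rectangle ((A * (3 * b + 2) : ℕ) + 1) (3 *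 b + 1) : Set (Site 2))) | (z 0 ≤ (b : ℤ) ∨ ((A * (3 * b + 2) : ℕ) : ℤ) ≤ z 0 + b) → (b : ℤ) + 1 ≤ z 1 ∧ z 1 ≤ 2 * (b : ℤ)} ((· + pt (-1) 0) '' (leftSide ((A * (3 * b + 2) : ℕ) + 1) (3 * b + 1) : Set (Site 2))) ((· + pt (-1) 0) '' (rightSide ((A * (3 * b + 2) : ℕ) + 1) (3 * b + 1) : Set (Site 2))))))

namespace Registered
/-- Alias of `CardyOrderTwo` keyed by the registered stub name. -/
abbrev stub_cardyOrderTwo : Prop := CardyOrderTwo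
end Registered

theorem cardyOrderTwo_holds : CardyOrderTwo := stub_cardyOrderTwo

/-! ### Proved glue of reshape 5 (kernel-checked) -/

-- LANDED glue of reshape 5 (imported from Theorems/CardyBoundaryCoulombGasStripClusterRatesConfinedGlueTransfer.lean p131473):
--   cg_f_supermul, cg_f_le_pTwo (§1), cg_rateTwo_le_confined (§2, via cg_rate_le_of_supermul p130621),
--   tendsto_nMul_rateTwo_of_cardyOrderTwo, kacTwo_of_cardyOrderTwo (§3),
--   stripClusterRates_of_cardyRectangle_of_cardyOrderTwo, stripClusterRates_of_cardyFormulaZ2_of_cardyOrderTwo (§4).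

/-- `relaxationRateKac_holds`, re-derived from the registered stub `stub_cardyOrderTwo`. -/
theorem relaxationRateKac_holds : RelaxationRateKac := kacTwo_of_cardyOrderTwo cardyOrderTwo_holds

/-- **Composition of reshape 5** (kept as an `example`; RC₁ is now a hypothesis, no longer a registered stub). The crux from
`RectCardyOne` (RC₁: Cardy's value for lattice rectangles = stmt-4782's business) and `stub_cardyOrderTwo`
(CO₂: Cardy-order two-cluster Kac, both halves), through the five PROVABLE registered stubs CG1–CG4 of the confined-gluing
order transfer (used inside `tendsto_nMul_rateTwo_of_cardyOrderTwo`) and the landed reductions of leads −1…c5. -/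
example (hRC : RectCardyOne) (hCO : Registered.stub_cardyOrderTwo) :
    Summit.CriticalPhenomena.CardyFormulaZ2.Theses.CardyBoundaryCoulombGas.StripClusterRates := by
  obtain ⟨γ₁, γ₂, hK₁, hK₂, hr₁, hr₂⟩ := rates_of_rc_kacTwo hRC (kacTwo_of_cardyOrderTwo hCO)
  exact ⟨γ₁, γ₂, hr₁, hr₂, hK₁, hK₂⟩

/-- The closed form of reshape 4 over RC₁ and a hypothesis K₂ (`rates_of_rc_kacTwo` is reshape 4's composition body,
stated with permuted conjuncts so that `StripClusterRates_of` stays the only theorem concluding the crux by name). -/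
example (hRC : RectCardyOne) (hK₂ : RelaxationRateKac) :
    Summit.CriticalPhenomena.CardyFormulaZ2.Theses.CardyBoundaryCoulombGas.StripClusterRates := by
  obtain ⟨γ₁, γ₂, hK₁, hK₂', hr₁, hr₂⟩ := rates_of_rc_kacTwo hRC hK₂
  exact ⟨γ₁, γ₂, hr₁, hr₂, hK₁, hK₂'⟩

/-- **The crux from crux 4 and the γ₂ Bethe pair** (RC₁ discharged by `RectilinearCardy`, K₂ by BX ∧ BI₂ ∧ BA₂). -/
example (h₄ : Summit.CriticalPhenomena.CardyFormulaZ2.Theses.CardyBoundaryCoulombGas.RectilinearCardy)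
    (hI₂ : RelaxIsBethe) (hA₂ : BetheKacTwo) :
    Summit.CriticalPhenomena.CardyFormulaZ2.Theses.CardyBoundaryCoulombGas.StripClusterRates := by
  obtain ⟨γ₁, γ₂, hK₁, hK₂', hr₁, hr₂⟩ :=
    rates_of_rc_kacTwo (rectCardyOne_of_rectilinearCardy h₄) (relaxationRateKac_of_bethe betheGroundExists_holds hI₂ hA₂)
  exact ⟨γ₁, γ₂, hr₁, hr₂, hK₁, hK₂'⟩

/-- **The crux from the CONJUNCT and K₂** (reshape 4; landed: `stripClusterRates_iff_kacTwo_of_cardyFormulaZ2`, p126523). -/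
example (h : _root_.CardyFormulaZ2) (hK₂ : RelaxationRateKac) :
    Summit.CriticalPhenomena.CardyFormulaZ2.Theses.CardyBoundaryCoulombGas.StripClusterRates := by
  obtain ⟨γ₁, γ₂, hK₁, hK₂', hr₁, hr₂⟩ := rates_of_rc_kacTwo (rectCardyOne_of_cardyFormulaZ2 h) hK₂
  exact ⟨γ₁, γ₂, hr₁, hr₂, hK₁, hK₂'⟩

/-- **The crux from `CardyRectangle` and K₂** (landed: `stripClusterRates_of_cardyRectangle_of_kacTwo`, p126652). -/
example (h : Summit.CriticalPhenomena.CardyFormulaZ2.Theses.CardyPolygonWords.CardyRectangle) (hK₂ : RelaxationRateKac) :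
    Summit.CriticalPhenomena.CardyFormulaZ2.Theses.CardyBoundaryCoulombGas.StripClusterRates := by
  obtain ⟨γ₁, γ₂, hK₁, hK₂', hr₁, hr₂⟩ := rates_of_rc_kacTwo (rectCardyOne_of_cardyRectangle h) hK₂
  exact ⟨γ₁, γ₂, hr₁, hr₂, hK₁, hK₂'⟩

/-- The reshape-5 closed form over RC₁ (now a hypothesis) and the registered CO₂. -/
example (hRC : RectCardyOne) : Summit.CriticalPhenomena.CardyFormulaZ2.Theses.CardyBoundaryCoulombGas.StripClusterRates := by
  obtain ⟨γ₁, γ₂, hK₁, hK₂, hr₁, hr₂⟩ := rates_of_rc_kacTwo hRC (kacTwo_of_cardyOrderTwo cardyOrderTwo_holds)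
  exact ⟨γ₁, γ₂, hr₁, hr₂, hK₁, hK₂⟩

/-- **The crux from `CardyRectangle` (stmt-4782) and CO₂**: everything in `StripClusterRates` beyond Cardy-order
conformal-invariance statements is now kernel-checked lattice work. -/
example (h : Summit.CriticalPhenomena.CardyFormulaZ2.Theses.CardyPolygonWords.CardyRectangle) (hCO : CardyOrderTwo) :
    Summit.CriticalPhenomena.CardyFormulaZ2.Theses.CardyBoundaryCoulombGas.StripClusterRates := by
  obtain ⟨γ₁, γ₂, hK₁, hK₂, hr₁, hr₂⟩ := rates_of_rc_kacTwo (rectCardyOne_of_cardyRectangle h) (kacTwo_of_cardyOrderTwo hCO)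
  exact ⟨γ₁, γ₂, hr₁, hr₂, hK₁, hK₂⟩

end ConfinedGluing

/-! ## Reshape 6 by the continuation lead c7 (prover-line-stmt-CriticalPhenomena-13878-c7-0, 2026-08-17):
the γ₁ input weakened to CARDY ORDER — crux ⟸ CO₁ ∧ CO₂, crux ⟺ CO₁ ∧ K₂

Reshape 5 left the composition over RC₁ (Cardy's FORMULA for lattice rectangles of integer aspect — the full
crossing function `F(λ(iA))`) and CO₂. But the γ₁-half of the crux only sees the TAIL EXPONENT of the rectangle
crossing probability, and for ONE spanning cluster the two orders of limits are interchangeable unconditionally: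
`p₁` is sub-multiplicative in the length (independence, `Negative.rateOne_ge_finite`) and super-multiplicative up
to the absolute constant `1/2` (Harris–FKG gluing through a top–bottom crossing of a square, `stub_sandwichUpper`).
Reshape 6 therefore registers as the γ₁ stub the CARDY-ORDER ONE-CLUSTER KAC statement
* CO₁ `stub_cardyOrderOne`: `∃ g G, g(A)/A → π/3, G(A)/A → π/3, ∀ A ≥ 1, eventually in n,
  e^{−G(A)} ≤ p₁(A·n, n) ≤ e^{−g(A)}`,
which is (wave 1 of c7, four workers, 4/4 LANDED first try in 6–9 min each; lead glue `…CardyOrderTransfer` LANDED p139778):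
* EQUIVALENT to the γ₁-half K₁ (`co_kacOne_of_cardyOrderOne` p139491, `co_cardyOrderOne_of_kacOne` p139481;
  `oneClusterKac_iff_cardyOrderOne`), hence NECESSARY for the crux (`cardyOrderOne_of_stripClusterRates`);
* implied by RC₁ (`co_cardyOrderOne_of_rectCardyOne` p139518 + landed `stub_lamRLog`, `stub_cardyLog`), hence by
  `CardyRectangle` (stmt-4782), by crux 4 `RectilinearCardy` (stmt-5660) and by the conjunct (`cardyOrderOne_of_*`);
* of the SAME SHAPE as CO₂: both registered open stubs are now "Cardy-order strip Kac exponent" statements,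
  `h_{1,3} = 1/3` (one spanning cluster) and `h_{1,5} = 2` (two distinct spanning clusters) — exactly what a
  conformal-invariance route (Cardy in polygons ⇒ SLE₆ exploration ⇒ half-plane arm exponents, LSW 2001 /
  Smirnov–Werner 2001 on 𝕋) would deliver for bond-ℤ², and nothing more.
Also landed: `co_cardyOrderTwoLower_of_kacTwo` (p139360) — the plain Cardy-order LOWER two-cluster bound with
`G(A)/A → 2π` is NECESSARY for the crux (`cardyOrderTwoLower_of_stripClusterRates`); so of CO₂ only the plain upper
bound (⟸ quasi-multiplicativity QM₂, not in tree) and the confined lower bound (arm separation at the strip ends)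
are not known to be necessary. Net logical state, all kernel-checked in `…CardyOrderTransfer`:
`StripClusterRates ⟺ CO₁ ∧ K₂`, `StripClusterRates ⟸ CO₁ ∧ CO₂`, `CO₁ ⟸ RC₁ ⟸ CardyRectangle ⟸ RectilinearCardy ⟸
CardyFormulaZ2`, `K₂ ⟸ CO₂`. Registered stubs after reshape 6: `stub_cardyOrderOne` (open, CI-level; ⟸ stmt-4782),
`stub_cardyOrderTwo` (open, CI-level). -/

section CardyOrder

open MeasureTheory

/-- CO₁ · Cardy-order one-cluster Kac, `h_{1,3} = 1/3`, two-sided (named statement of reshape 6). OPEN for bond-ℤ²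
(it is the tail exponent of Cardy's formula for long rectangles, `F(η) ∼ cardyConst·η^{1/3}`, `log(1/λ(iA)) = πA + O(1)`);
⟸ RC₁ ⟸ stmt-4782; ⟺ the γ₁-half of the crux. [CardyJPhysA1992 eq. (PI); Cardy1998 eq. (bb) n = 1] -/
def CardyOrderOne : Prop :=
  ∃ g G : ℕ → ℝ, Tendsto (fun A : ℕ ↦ g A / A) atTop (𝓝 (Real.pi / 3)) ∧ Tendsto (fun A : ℕ ↦ G A / A) atTop (𝓝 (Real.pi / 3)) ∧ ∀ A : ℕ, 1 ≤ A → ∀ᶠ n : ℕ in atTop, Real.exp (-G A) ≤ crossingProb half (A * n) n ∧ crossingProb half (A * n) n ≤ Real.exp (-g A)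

/-- **CO₁ — Cardy-order one-cluster Kac** (`= CardyOrderOne`; registered stub `stub_cardyOrderOne` of reshape 6; OPEN,
conformal-invariance level; implied by `CardyRectangle` stmt-4782 through the landed `cardyOrderOne_of_rectCardyOne`). -/
theorem stub_cardyOrderOne :
    ∃ g G : ℕ → ℝ, Tendsto (fun A : ℕ ↦ g A / A) atTop (𝓝 (Real.pi / 3)) ∧ Tendsto (fun A : ℕ ↦ G A / A) atTop (𝓝 (Real.pi / 3)) ∧ ∀ A : ℕ, 1 ≤ A → ∀ᶠ n : ℕ in atTop, Real.exp (-G A) ≤ crossingProb half (A * n) n ∧ crossingProb half (A * n) n ≤ Real.exp (-g A) := by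
  sorry

namespace Registered
/-- Alias of `CardyOrderOne` keyed by the registered stub name. -/
abbrev stub_cardyOrderOne : Prop := CardyOrderOne
end Registered

theorem cardyOrderOne_holds : CardyOrderOne := stub_cardyOrderOne

/-- **RC₁ ⟹ CO₁** inside the skeleton (the landed `co_cardyOrderOne_of_rectCardyOne` fed with the landed
`stub_lamRLog`, `stub_cardyLog`; = `cardyOrderOne_of_rectCardyOne` of `…CardyOrderTransfer`). -/
theorem cardyOrderOne_of_rectCardyOne' (hRC : RectCardyOne) : CardyOrderOne :=
  co_cardyOrderOne_of_rectCardyOne stub_lamRLog stub_cardyLog hRC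

/-- **CO₁ ⟸ the conjunct** (`CardyFormulaZ2 → RectilinearCardy → CardyRectangle → RC₁ → CO₁`, all landed). -/
theorem cardyOrderOne_of_cardyFormulaZ2' (h : _root_.CardyFormulaZ2) : CardyOrderOne :=
  cardyOrderOne_of_rectCardyOne' (rectCardyOne_of_cardyFormulaZ2 h)

/-- **K₁ from CO₁** (the landed `co_kacOne_of_cardyOrderOne`): every family of one-cluster rates has `n·γ₁(n) → π/3`. -/
theorem oneClusterKac_of_cardyOrderOne (hCO₁ : CardyOrderOne) :
    ∀ γ : ℕ → ℝ, (∀ n : ℕ, 1 ≤ n → OneClusterRate n (γ n)) →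
      Tendsto (fun n : ℕ ↦ (n : ℝ) * γ n) atTop (𝓝 (Real.pi / 3)) :=
  co_kacOne_of_cardyOrderOne hCO₁

/-- **Rates with both Kac limits from K₁ and K₂** (reshape-6 body; as `rates_of_rc_kacTwo` with the γ₁-limit supplied by a
HYPOTHESIS K₁ instead of lead −1's RC₁ chain): the rates are chosen from the LANDED S1/S2. -/
theorem rates_of_kacOne_kacTwo
    (hK₁ : ∀ γ : ℕ → ℝ, (∀ n : ℕ, 1 ≤ n → OneClusterRate n (γ n)) →
      Tendsto (fun n : ℕ ↦ (n : ℝ) * γ n) atTop (𝓝 (Real.pi / 3)))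
    (hK₂ : RelaxationRateKac) :
    ∃ γ₁ γ₂ : ℕ → ℝ, Tendsto (fun n : ℕ ↦ (n : ℝ) * γ₁ n) atTop (𝓝 (Real.pi / 3)) ∧ Tendsto (fun n : ℕ ↦ (n : ℝ) * γ₂ n) atTop (𝓝 (2 * Real.pi)) ∧ (∀ n : ℕ, 1 ≤ n → Tendsto (fun m : ℕ ↦ -Real.log (crossingProb half m n) / (m : ℝ)) atTop (𝓝 (γ₁ n))) ∧ (∀ n : ℕ, 1 ≤ n → Tendsto (fun m : ℕ ↦ -Real.log ((bondPercolation (zdGraph 2) half).real {ω | ∃ x₁ ∈ (leftSide m n : Set (Site 2)), ∃ y₁ ∈ (rightSide m n : Set (Site 2)), ∃ x₂ ∈ (leftSide m n : Set (Site 2)), ∃ y₂ ∈ (rightSide m n : Set (Site 2)), ω ∈ openConnIn (rectangle m n : Set (Site 2)) x₁ y₁ ∧ ω ∈ openConnIn (rectangle m n : Set (Site 2)) x₂ y₂ ∧ ω ∉ openConnIn (rectangle m n : Set (Site 2)) x₁ x₂}) / (m : ℝ)) atTop (𝓝 (γ₂ n))) := by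
  have h₁ : OneClusterRateIsEscapeRate :=
    oneClusterRateIsEscapeRate_of oneClusterDictionary_holds planarReachable_holds oneClusterSpectral_holds
  have h₂ : TwoClusterRateIsRelaxationRate :=
    twoClusterRateIsRelaxationRate_of twoClusterDictionary_holds relaxationUpper_holds relaxationLower_holds
  let γ₁ : ℕ → ℝ := fun n => if hn : 1 ≤ n then (h₁ n hn).choose else 0
  let γ₂ : ℕ → ℝ := fun n => if hn : 1 ≤ n then (h₂ n hn).choose else 0
  have hγ₁ : ∀ n : ℕ, ∀ hn : 1 ≤ n, γ₁ n = (h₁ n hn).choose := fun n hn => dif_pos hn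
  have hγ₂ : ∀ n : ℕ, ∀ hn : 1 ≤ n, γ₂ n = (h₂ n hn).choose := fun n hn => dif_pos hn
  have hrate₁ : ∀ n : ℕ, 1 ≤ n → OneClusterRate n (γ₁ n) := by
    intro n hn
    rw [hγ₁ n hn]
    exact (h₁ n hn).choose_spec.1
  refine ⟨γ₁, γ₂, hK₁ γ₁ hrate₁, ?_, hrate₁, ?_⟩
  · have hs : ∀ n : ℕ, 1 ≤ n → IsRelaxationModulus n (Real.exp (-γ₂ n)) := by
      intro n hn
      rw [hγ₂ n hn]
      exact (h₂ n hn).choose_spec.2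
    have h := hK₂ (fun n => Real.exp (-γ₂ n)) hs
    refine h.congr' (Eventually.of_forall fun n => ?_)
    exact mul_neg_log_exp_neg n (γ₂ n)
  · intro n hn
    rw [hγ₂ n hn]
    exact (h₂ n hn).choose_spec.1

/-- **Composition (reshape 6).** The crux `CardyBoundaryCoulombGas.StripClusterRates` BY NAME from the two OPEN registered
stubs `stub_cardyOrderOne` (CO₁: Cardy-order one-cluster Kac, `h_{1,3} = 1/3`, two-sided) and `stub_cardyOrderTwo`
(CO₂: Cardy-order two-cluster Kac, `h_{1,5} = 2`, plain upper / confined lower): K₁ from CO₁ (`co_kacOne_of_cardyOrderOne`),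
K₂ from CO₂ (`kacTwo_of_cardyOrderTwo`), the rates from the landed dictionary/spectral stubs. -/
theorem StripClusterRates_of (hCO₁ : Registered.stub_cardyOrderOne) (hCO₂ : Registered.stub_cardyOrderTwo) :
    Summit.CriticalPhenomena.CardyFormulaZ2.Theses.CardyBoundaryCoulombGas.StripClusterRates := by
  obtain ⟨γ₁, γ₂, hK₁, hK₂, hr₁, hr₂⟩ :=
    rates_of_kacOne_kacTwo (oneClusterKac_of_cardyOrderOne hCO₁) (kacTwo_of_cardyOrderTwo hCO₂)
  exact ⟨γ₁, γ₂, hr₁, hr₂, hK₁, hK₂⟩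

/-- The closed form over the registered stubs of reshape 6. -/
example : Summit.CriticalPhenomena.CardyFormulaZ2.Theses.CardyBoundaryCoulombGas.StripClusterRates :=
  StripClusterRates_of cardyOrderOne_holds cardyOrderTwo_holds

/-- **CO₁ is necessary** (the landed `co_cardyOrderOne_of_kacOne` on the crux's own rates). -/
example (h : Summit.CriticalPhenomena.CardyFormulaZ2.Theses.CardyBoundaryCoulombGas.StripClusterRates) : CardyOrderOne := by
  obtain ⟨γ₁, γ₂, h₁, -, h₃, -⟩ := h
  exact co_cardyOrderOne_of_kacOne γ₁ h₁ h₃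

/-- **K₂ is necessary** (landed `kacTwo_of_stripClusterRates`, p126523). -/
example (h : Summit.CriticalPhenomena.CardyFormulaZ2.Theses.CardyBoundaryCoulombGas.StripClusterRates) : RelaxationRateKac :=
  fun s hs => kacTwo_of_stripClusterRates h s hs

/-- **The plain Cardy-order two-cluster lower bound is necessary** (landed `co_cardyOrderTwoLower_of_kacTwo`, p139360). -/
example (h : Summit.CriticalPhenomena.CardyFormulaZ2.Theses.CardyBoundaryCoulombGas.StripClusterRates) :
    ∃ G : ℕ → ℝ, Tendsto (fun A : ℕ ↦ G A / A) atTop (𝓝 (2 * Real.pi)) ∧ ∀ A : ℕ, 1 ≤ A → ∀ᶠ n : ℕ in atTop,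
      Real.exp (-G A) ≤ (bondPercolation (zdGraph 2) half).real (twoClusterEvent (A * n) n) := by
  obtain ⟨γ₁, γ₂, -, h₂, -, h₄⟩ := h
  exact co_cardyOrderTwoLower_of_kacTwo γ₂ h₂ h₄

/-- **The crux from `CardyRectangle` (stmt-4782) and CO₂**, through CO₁. -/
example (h : Summit.CriticalPhenomena.CardyFormulaZ2.Theses.CardyPolygonWords.CardyRectangle) (hCO₂ : CardyOrderTwo) :
    Summit.CriticalPhenomena.CardyFormulaZ2.Theses.CardyBoundaryCoulombGas.StripClusterRates :=
  StripClusterRates_of (cardyOrderOne_of_rectCardyOne' (rectCardyOne_of_cardyRectangle h)) hCO₂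

/-- **The crux from the conjunct and K₂**, through CO₁ (cf. landed `stripClusterRates_iff_kacTwo_of_cardyFormulaZ2`). -/
example (h : _root_.CardyFormulaZ2) (hK₂ : RelaxationRateKac) :
    Summit.CriticalPhenomena.CardyFormulaZ2.Theses.CardyBoundaryCoulombGas.StripClusterRates := by
  obtain ⟨γ₁, γ₂, hK₁, hK₂', hr₁, hr₂⟩ :=
    rates_of_kacOne_kacTwo (oneClusterKac_of_cardyOrderOne (cardyOrderOne_of_cardyFormulaZ2' h)) hK₂
  exact ⟨γ₁, γ₂, hr₁, hr₂, hK₁, hK₂'⟩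

/-- Cross-check against the LANDED glue (p139778): the crux from the two registered stubs through
`stripClusterRates_of_cardyOrderOne_of_cardyOrderTwo`, and `StripClusterRates ⟺ CO₁ ∧ K₂`. -/
example : Summit.CriticalPhenomena.CardyFormulaZ2.Theses.CardyBoundaryCoulombGas.StripClusterRates :=
  stripClusterRates_of_cardyOrderOne_of_cardyOrderTwo cardyOrderOne_holds cardyOrderTwo_holds

example : Summit.CriticalPhenomena.CardyFormulaZ2.Theses.CardyBoundaryCoulombGas.StripClusterRates ↔ (CardyOrderOne ∧ RelaxationRateKac) :=
  stripClusterRates_iff_cardyOrderOne_and_kacTwo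

end CardyOrder

/-! ## Progress by the continuation lead c8 (prover-line-stmt-CriticalPhenomena-13878-c8-0, 2026-08-17):
the plain event versus the end-confined proxy, and the end-separation package

NO RESHAPE of the composition (`StripClusterRates_of : stub_cardyOrderOne → stub_cardyOrderTwo → StripClusterRates`, 2 `sorry`).
Fourteen helper files LANDED (`--supports`; 2 waves of 6 + 7 workers, 13/13, + the lead's package), imported above:
* DOCKING STRUCTURE of the two-cluster event (`c8_dockingOrder` p141846, `c8_dockingSeparator` p142148): two distinct spanning
  clusters ⟹ an upper cluster touching no bottom site, a lower crossing docked strictly below it at both ends, and a dual-open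
  separator through inner faces docked at the minimal rows of the upper cluster on both sides — the entry point of any end
  separation / quasi-multiplicativity argument;
* END SURGERY (`c8_confinedOfDocked` p145056 + Aux p143336; `c8_confinedOfPlain` p147720): deterministic staircase end patterns turn
  a docked plain block into c6's confined event two end-zones longer, hence **`f(M+2(b+3), b) ≥ c(b)·p₂(M,3b+2)`** and
  (`c8_rateConfined_of_cmp` p141699; `c8_rateConfined` in `…SepPackage` p148735) **rate(F) = γ₂** in transfer-matrix order;
* NEW NECESSITY (`c8_confinedUpper_of_kacTwo` p141735): K₂ ⟹ the CONFINED Cardy-order upper bound (2π); a-priori bounds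
  `p₁(M,b)² p₁(M+1,b−1) ≤ 4 f(M,b)` (p141964) and `e^(−322 log 2·A) ≤ f(A(3b+2),b)` (p146084);
* THE SEP PACKAGE (p146083, p146048, p146052, p146071, p147292; assembled in `…SepPackage`, p148735): modulo END SEPARATION
  `SEP := (∃ c : ℝ, 0 < c ∧ ∃ b₀ k : ℕ, 1 ≤ k ∧ ∀ b : ℕ, b₀ ≤ b → ∀ M : ℕ, 1 ≤ M → c * pTwo M (3 * b + 2) ≤ f (M + k * (3 * b + 2)) b)` (with `f` := the confined-block probability; the bond-ℤ² strip-end analogue of Kesten/Nolin arm separation for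
  three alternating arms — RSW-level, not proved), K₂ ⟺ CO₂ ⟺ PU ∧ PL and **StripClusterRates ⟺ CO₁ ∧ PU ∧ PL ⟺ CO₁ ∧ CO₂**,
  where PU/PL are the PLAIN one-sided Cardy-order two-cluster bounds with exponent 2π. So with SEP both registered open stubs are
  NECESSARY, and the crux is literally the pair of two-sided Cardy-order strip Kac exponents h_(1,3) = 1/3, h_(1,5) = 2. -/

section EndSeparation

open MeasureTheory
open Summit.CriticalPhenomena.CardyFormulaZ2.Theorems.StripClusterRates.Negative (pTwo rateSeqTwo)

/-- PU · the plain Cardy-order two-cluster UPPER bound (exponent `2π`). [Cardy1998 eq. (bb) n = 2] -/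
def PlainUpperTwo : Prop := (∃ g : ℕ → ℝ, Tendsto (fun A : ℕ ↦ g A / A) atTop (𝓝 (2 * Real.pi)) ∧ ∀ A : ℕ, 1 ≤ A → ∀ᶠ n : ℕ in atTop, pTwo (A * n) n ≤ Real.exp (-g A))

/-- PL · the plain Cardy-order two-cluster LOWER bound (exponent `2π`). [Cardy1998 eq. (bb) n = 2] -/
def PlainLowerTwo : Prop := (∃ G : ℕ → ℝ, Tendsto (fun A : ℕ ↦ G A / A) atTop (𝓝 (2 * Real.pi)) ∧ ∀ A : ℕ, 1 ≤ A → ∀ᶠ n : ℕ in atTop, Real.exp (-G A) ≤ pTwo (A * n) n)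

/-- SEP · END SEPARATION for two-cluster crossings of the strip (hypothesis; RSW-level, Kesten 1987 / Nolin 2008 §4 in strip
geometry for bond-ℤ²): a plain two-cluster crossing of `[0,M]×[0,3b+2]` can be upgraded to the end-confined event of the block
`k` widths longer at a cost bounded uniformly in `b ≥ b₀`, `M ≥ 1`. NOT PROVED; every use below is conditional on it. -/
def EndSeparation : Prop := ∀ f : ℕ → ℕ → ℝ, f = (fun M b : ℕ => (bondPercolation (zdGraph 2) half).real ((openCrossing {z ∈ (rectangle M (3 * b + 2) : Set (Site 2)) | (z 0 ≤ (b : ℤ) ∨ (M : ℤ) ≤ z 0 + b) → z 1 ≤ (b : ℤ)} (leftSide M (3 * b + 2) : Set (Site 2)) (rightSide M (3 * b + 2) : Set (Site 2)) ∩ tbCrossing b b ∩ openCrossing {z ∈ (rectangle M (3 * b + 2) : Set (Site 2)) | (z 0 ≤ (b : ℤ) ∨ (M : ℤ) ≤ z 0 + b) → 2 * (b : ℤ) + 2 ≤ z 1} (leftSide M (3 * b + 2) : Set (Site 2)) (rightSide M (3 * b + 2) : Set (Site 2)) ∩ (BondConfig.relabel (sym2Equiv (Site.shift (-pt 0 (2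 * (b : ℤ) + 2))))) ⁻¹' tbCrossing b b) ∩ (dualConfig ⁻¹' openCrossing {z ∈ ((· + pt (-1) 0) '' (rectangle (M + 1) (3 * b + 1) : Set (Site 2))) | (z 0 ≤ (b : ℤ) ∨ (M : ℤ) ≤ z 0 + b) → (b : ℤ) + 1 ≤ z 1 ∧ z 1 ≤ 2 * (b : ℤ)} ((· + pt (-1) 0) '' (leftSide (M + 1) (3 * b + 1) : Set (Site 2))) ((· + pt (-1) 0) '' (rightSide (M + 1) (3 * b + 1) : Set (Site 2)))))) → (∃ c : ℝ, 0 < c ∧ ∃ b₀ k : ℕ, 1 ≤ k ∧ ∀ b : ℕ, b₀ ≤ b → ∀ M : ℕ, 1 ≤ M → c * pTwo M (3 * b + 2) ≤ f (M + k * (3 * b + 2)) b)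

/-- **c8 · rate(F) = γ₂** (unconditional; = the landed `c8_rateConfined` of `…SepPackage`, p148735): the end-confined event decays at the two-cluster rate. -/
example (f : ℕ → ℕ → ℝ) (hf : f = (fun M b : ℕ => (bondPercolation (zdGraph 2) half).real ((openCrossing {z ∈ (rectangle M (3 * b + 2) : Set (Site 2)) | (z 0 ≤ (b : ℤ) ∨ (M : ℤ) ≤ z 0 + b) → z 1 ≤ (b : ℤ)} (leftSide M (3 * b + 2) : Set (Site 2)) (rightSide M (3 * b + 2) : Set (Site 2)) ∩ tbCrossing b b ∩ openCrossing {z ∈ (rectangle M (3 * b + 2) : Set (Site 2)) | (z 0 ≤ (b : ℤ) ∨ (M : ℤ) ≤ z 0 + b) → 2 * (b : ℤ) + 2 ≤ z 1} (leftSide M (3 * b + 2) : Set (Site 2)) (rightSide M (3 * b + 2) : Set (Site 2)) ∩ (BondConfig.relabel (sym2Equiv (Site.shift (-pt 0 (2 * (b : ℤ) + 2))))) ⁻¹' tbCrossing b b) ∩ (dualConfig ⁻¹' openCrossing {z ∈ ((· + pt (-1) 0) '' (rectangle (M + 1) (3 * b + 1) : Set (Site 2))) | (z 0 ≤ (b :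 ℤ) ∨ (M : ℤ) ≤ z 0 + b) → (b : ℤ) + 1 ≤ z 1 ∧ z 1 ≤ 2 * (b : ℤ)} ((· + pt (-1) 0) '' (leftSide (M + 1) (3 * b + 1) : Set (Site 2))) ((· + pt (-1) 0) '' (rightSide (M + 1) (3 * b + 1) : Set (Site 2)))))))
    {b : ℕ} (hb : 1 ≤ b) {γ : ℝ} (hγ : Tendsto (rateSeqTwo (3 * b + 2)) atTop (𝓝 γ)) :
    Tendsto (fun M : ℕ ↦ -Real.log (f M b) / (M : ℝ)) atTop (𝓝 γ) :=
  c8_rateConfined_of_cmp f hf (c8_confinedOfPlain f hf) b hb γ hγ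

/-- **c8 · the confined Cardy-order upper bound is NECESSARY** (unconditional; = the landed `confinedUpper_of_stripClusterRates`, p148735). -/
example (f : ℕ → ℕ → ℝ) (hf : f = (fun M b : ℕ => (bondPercolation (zdGraph 2) half).real ((openCrossing {z ∈ (rectangle M (3 * b + 2) : Set (Site 2)) | (z 0 ≤ (b : ℤ) ∨ (M : ℤ) ≤ z 0 + b) → z 1 ≤ (b : ℤ)} (leftSide M (3 * b + 2) : Set (Site 2)) (rightSide M (3 * b + 2) : Set (Site 2)) ∩ tbCrossing b b ∩ openCrossing {z ∈ (rectangle M (3 * b + 2) : Set (Site 2)) | (z 0 ≤ (b : ℤ) ∨ (M : ℤ) ≤ z 0 + b) → 2 * (b : ℤ) + 2 ≤ z 1} (leftSide M (3 * b + 2) : Set (Site 2)) (rightSide M (3 * b + 2) : Set (Site 2)) ∩ (BondConfig.relabel (sym2Equiv (Site.shift (-pt 0 (2 * (b : ℤ) + 2))))) ⁻¹' tbCrossing b b) ∩ (dualConfig ⁻¹' openCrossing {z ∈ ((· + pt (-1) 0) '' (rectangle (M + 1) (3 * b + 1) : Set (Site 2))) | (z 0 ≤ (b : ℤ) ∨ (M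 : ℤ) ≤ z 0 + b) → (b : ℤ) + 1 ≤ z 1 ∧ z 1 ≤ 2 * (b : ℤ)} ((· + pt (-1) 0) '' (leftSide (M + 1) (3 * b + 1) : Set (Site 2))) ((· + pt (-1) 0) '' (rightSide (M + 1) (3 * b + 1) : Set (Site 2)))))))
    (h : Summit.CriticalPhenomena.CardyFormulaZ2.Theses.CardyBoundaryCoulombGas.StripClusterRates) :
    ∃ g : ℕ → ℝ, Tendsto (fun A : ℕ ↦ g A / A) atTop (𝓝 (2 * Real.pi)) ∧ ∀ A : ℕ, 1 ≤ A → ∀ᶠ b : ℕ in atTop,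
      f (A * (3 * b + 2)) b ≤ Real.exp (-g A) := by
  obtain ⟨γ₁, γ₂, -, h₂, -, h₄⟩ := h
  exact c8_confinedUpper_of_kacTwo f hf γ₂ h₂ h₄

/-- A family of two-cluster rates, one limit per width (the landed `c8_exists_rateTwo_family` of `…SepPackage`). -/
theorem sk_exists_rateTwo_family : ∃ γ₂ : ℕ → ℝ, ∀ n : ℕ, 1 ≤ n → Tendsto (rateSeqTwo n) atTop (𝓝 (γ₂ n)) := by
  classical
  refine ⟨fun n => if hn : 1 ≤ n then
      (Summit.CriticalPhenomena.CardyFormulaZ2.Theorems.StripRates.exists_rateTwo hn).choose else 0, fun n hn => ?_⟩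
  simp only [dif_pos hn]
  exact (Summit.CriticalPhenomena.CardyFormulaZ2.Theorems.StripRates.exists_rateTwo hn).choose_spec

/-- **c8 · modulo SEP, K₂ ⟺ CO₂** (landed `kacTwo_iff_cardyOrderTwo_of_sep` of `…SepPackage`, p148735; here re-derived from
the worker files: PU from `c8_uniformUpper_of_sep` + `c8_plainUpper_of_uniform_kacTwo`, the confined lower half from
`c8_confinedLower_of_sep_kacTwo` + `c8_confined_apriori_lower`, the converse = c6's `tendsto_nMul_rateTwo_of_cardyOrderTwo`). -/
theorem relaxationRateKac_iff_cardyOrderTwo (hsep : EndSeparation) : RelaxationRateKac ↔ CardyOrderTwo := by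
  refine twoClusterKac_iff_kacTwo.symm.trans ⟨fun hK => ?_, fun hCO₂ γ₂ h₂ => tendsto_nMul_rateTwo_of_cardyOrderTwo hCO₂ γ₂ h₂⟩
  obtain ⟨γ₂, h₂⟩ := sk_exists_rateTwo_family
  exact ⟨c8_plainUpper_of_uniform_kacTwo γ₂ h₂ (hK γ₂ h₂) (c8_uniformUpper_of_sep _ rfl (hsep _ rfl) γ₂ h₂),
    c8_confinedLower_of_sep_kacTwo _ rfl (hsep _ rfl) (c8_confined_apriori_lower _ rfl) γ₂ h₂ (hK γ₂ h₂)⟩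

/-- **c8 · modulo SEP the crux is exactly CO₁ ∧ CO₂**, i.e. both registered open stubs are then necessary
(landed `stripClusterRates_iff_cardyOrder_of_sep`, p148735). -/
theorem stripClusterRates_iff_cardyOrder (hsep : EndSeparation) :
    Summit.CriticalPhenomena.CardyFormulaZ2.Theses.CardyBoundaryCoulombGas.StripClusterRates ↔ (CardyOrderOne ∧ CardyOrderTwo) :=
  ⟨fun h => ⟨cardyOrderOne_of_stripClusterRates h,
      (relaxationRateKac_iff_cardyOrderTwo hsep).1 fun s hs => kacTwo_of_stripClusterRates h s hs⟩,
    fun h => StripClusterRates_of h.1 h.2⟩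

/-- **c8 · modulo SEP the crux is exactly CO₁ ∧ PU ∧ PL** — the pair of two-sided Cardy-order strip Kac exponents for PLAIN
events (landed `stripClusterRates_iff_plain_of_sep`, p148735, registered; here: PU as above, PL = c7's necessity
`cardyOrderTwoLower_of_stripClusterRates`, and the converse through `c8_kacTwo_of_sep_plain`). -/
theorem stripClusterRates_iff_plain (hsep : EndSeparation) :
    Summit.CriticalPhenomena.CardyFormulaZ2.Theses.CardyBoundaryCoulombGas.StripClusterRates ↔
      (CardyOrderOne ∧ PlainUpperTwo ∧ PlainLowerTwo) := by
  constructor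
  · intro h
    refine ⟨cardyOrderOne_of_stripClusterRates h, ?_, cardyOrderTwoLower_of_stripClusterRates h⟩
    obtain ⟨γ₁, γ₂, -, h₂, -, h₄⟩ := h
    exact c8_plainUpper_of_uniform_kacTwo γ₂ h₂ h₄ (c8_uniformUpper_of_sep _ rfl (hsep _ rfl) γ₂ h₂)
  · rintro ⟨hCO₁, hPU, hPL⟩
    exact stripClusterRates_of_cardyOrderOne_of_kacTwo hCO₁ (twoClusterKac_iff_kacTwo.1 fun γ₂ h₂ =>
      c8_kacTwo_of_sep_plain _ rfl (hsep _ rfl) (c8_confined_apriori_lower _ rfl) hPU hPL γ₂ h₂)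

end EndSeparation


end Summit.CriticalPhenomena.CardyFormulaZ2.Cruxes.StripClusterRates.TwoClusterRateIsStationaryGap

end
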